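import Summits.BirchSwinnertonDyer.BirchSwinnertonDyer.Theorems.EisensteinPrimesBSDpOnCellCOfNamedFactsV17P
import Summits.BirchSwinnertonDyer.BirchSwinnertonDyer.Theorems.EisensteinPrimesBSDpOnCellCOfNamedFactsV22
import Summits.BirchSwinnertonDyer.BirchSwinnertonDyer.Theorems.EisensteinPrimesBSDpOnCellCTelescopeK2WeightTwoFg
import Summits.BirchSwinnertonDyer.BirchSwinnertonDyer.Theorems.EisensteinPrimesBSDpOnCellCTelescopeCarrierSplit
import Summits.BirchSwinnertonDyer.BirchSwinnertonDyer.Theorems.EisensteinPrimesBSDpOnCellCTelescopeCarrierAlgOfWitness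
import Summits.BirchSwinnertonDyer.BirchSwinnertonDyer.Theorems.SignedBaseChangeAnticyclotomicEisensteinDivisibilitySpecializationHerbrand
import Summits.BirchSwinnertonDyer.Rank1Residual.X11b.BDPRouteOpenInputDegenerateFrame
import Literature.NumberTheory.EllipticCurves.IwasawaAlgebraRankOneIdealProofs
import Literature.NumberTheory.EllipticCurves.IwasawaSelmerIsTorsionProofs
import Literature.NumberTheory.IwasawaTheory.IwasawaAlgebraTwoVarRegularProofs
import Summits.BirchSwinnertonDyer.BirchSwinnertonDyer.Theorems.EisensteinPrimesBSDpOnCellCTelescopeK2WeightControl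
import Summits.BirchSwinnertonDyer.BirchSwinnertonDyer.Theorems.EisensteinPrimesBSDpOnCellCTelescopeK2ControlAlgebra
import Summits.BirchSwinnertonDyer.BirchSwinnertonDyer.Theorems.EisensteinPrimesBSDpOnCellCRetractionSpecializationHerbrand
import Summits.BirchSwinnertonDyer.BirchSwinnertonDyer.Theorems.EisensteinPrimesBSDpOnCellCRetractionSpecializationTorsion
import Summits.BirchSwinnertonDyer.BirchSwinnertonDyer.Theorems.EisensteinPrimesBSDpOnCellCTelescopeCarrierAlgWOfDivInt
import Literature.NumberTheory.EllipticCurves.IwasawaAlgebraPseudoNullProofs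
import Summits.BirchSwinnertonDyer.BirchSwinnertonDyer.Theorems.EisensteinPrimesBSDpOnCellCTelescopeK2PurityOfPTorsionPseudoNull
import HarnessLib

/-!
**v1.2 (ideator bsd-idea-12 g38, 2026-08-30) — W4 REDUCED TO THE `p`-TOLERANT «ROUTE G′» INPUT W4⁰.** NEW STUB W4⁰ `stub_bigPseudoNullPTorsion`
(bench L, route G′): for every `ρ₂` with FD, UNDER (fg) ∧ (reg₀): EVERY PSEUDO-NULL `B`-SUBMODULE OF `X₂ = XBig κ ρ₂ 𝔭̄ ∅` IS KILLED BY A POWER OF `p` —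
the `p`-tolerant form of Greenberg's «`X₂` has no non-zero pseudo-null submodule» (Greenberg 2016 Prop. 4.1.1 (c)). Tolerant, because the strict form
can fail when some unramified local condition `H¹_ur(K_w, M₂)`, `w ∣ N`, is not almost divisible (memo `W-PRICING-n2.md` §W4-G (G5-w): then
`X₂ ⊇ (S_𝓛/S_{𝓛_div})^∨`, pseudo-null and in general non-zero), whereas Prop. 4.1.1 for the almost-divisible core `𝓛_div`, the AUTOMATIC bound «the maximal pseudo-null
submodule of `V ⊗̂_{ℤ_p⟦X⟧} B` is `F⟦T⟧`, killed by `p^a`» at `w ∣ N` (flat base change of associated primes), and the extension principle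
(`TelescopeK2PurityOfPTorsionPseudoNull.forall_isPseudoNull_pow_smul_eq_zero_of_quotient`, p754825) give W4⁰ with NO local hypothesis at `w ∣ N`
(memo rev 1.7 §W4-G′). NEW THEOREM (sorry-free) `weightTwoPurity_of_pTolerant : W2 → W3 → W4⁰ → W4` (W1 by name): (fg) = `bigModuleFinite`; (reg₀) exactly
as in the kernel (W2's kernel clause + W3's torsion, `s ≡ φ₀ s (mod C X)`, x2-p2 g18's determinant trick); then the LEAD cruxlead-19034 g2's
`TelescopeK2PurityOfNoPseudoNull` (`X₂[C X]` is pseudo-null: killed by the prime `C X` and by `s ∉ (C X)`) in its `p`-tolerant dress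
`TelescopeK2PurityOfPTorsionPseudoNull.exists_span_C_pow_le_charIdeal_torsionBy_CX_of_pTolerant` (p754825): `p^m` kills `X₂[C X]`, which is finitely
generated over `ℤ_p⟦T⟧` (p751472 change of rings), so `(C p^{m·n}) ⊆ char_Λ(X₂[C X])`. NEW KERNEL `weightTwoControlOfPub_of_pTolerant :
W2 → ((PUB) → (I-E)) → W4⁰ → <v10 `stub_weightTwoControlOfPub` text>` (sorry-free; axioms {propext, Classical.choice, Quot.sound}). W4 `stub_weightTwoPurity`
is KEPT as a stub (its text is the `h4` binder of the kernels and of the LEAD g3's `…TelescopeK2WeightTwoControlOfPubOfSubleaves` (p754678), and the target of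
the alternative route `Lines/telescopeK2purity.lean`); STUBS NOW: 4 = W2, `stub_ESideOfPub` (discharged in the tree by the LEAD's p754143
`TelescopeK2XBigUnramifiedCellC.inputE_of_pub`, kept here verbatim), W4, W4⁰ — with W4 ⟸ W2 ∧ W3 ∧ W4⁰ proved here, the OPEN INPUTS of N2|pub along
route G′ are W2 ∧ W4⁰ (+ PUB). UNREGISTERED workfile (W-79: the ideator never registers; the LEAD decides).
UNREGISTERED workfile (W-79). v1.1 text follows.

**v1.1 (ideator bsd-idea-12 g37, 2026-08-30) — RE-CUT UNDER TELESCOPE v10 (`stub_weightTwoControlOfPub : (PUB) → N2`), TWO SUB-LEAVES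
DISCHARGED BY NAME.** W1 `stub_bigModuleFinite` is now the THEOREM `bigModuleFinite` (:= `TelescopeK2WeightTwoFg.bigModuleFinite`, p752319 = 63400eb87ae8 ←
p751255/p750844 cofinite generation of `A₂ ⊗ B^*` from (tor)+(fd₀) ← p748872/p748332 Greenberg 2006 Prop. 3.2 + inflation); W3
`stub_weightTwoTransport` is now the THEOREM `weightTwoTransport_of_ESide : (I-E) → W3` (:= `TelescopeK2WeightTwoFg.weightTwoTransport_of_E` =
the LEAD cruxlead-19034 g3's `TelescopeK2WeightTwoTransportOfInputs.weightTwoTransport_of_inputs` (p751200, core p750710) with its (W3-fg) input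
discharged by `TelescopeK2WeightTwoFg.weightTwoFg`), and the E-side input is the NEW STUB `stub_ESideOfPub : (PUB) → (I-E)` — (I-E) = the LEAD's
`hE` binder TOKEN FOR TOKEN (X_ac-side: `XBig κ (E[p^∞]-rep) 𝔭̄ ∅` finitely generated and torsion over `Λ`), prefixed by the v10 cite stub
`stub_publishedFacts` text because its tree proof (`isTorsion_xAc_other_of_cellC`) consumes GZK / modularity named facts (LEAD FINDING 23:31:06Z,
the reason for v10). NEW KERNEL `weightTwoControlOfPub_of_subleaves : W2 → ((PUB) → (I-E)) → W4 → <v10 `stub_weightTwoControlOfPub` text>`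
(sorry-free: `fun hPub ↦ weightTwoControl_of_subleaves bigModuleFinite h2 (weightTwoTransport_of_ESide (hE hPub)) h4`). STUBS NOW: 3 =
W2 `stub_weightTwoControlMap` (x2-p2 g19: control map, bench M/L), `stub_ESideOfPub` (LEAD g3: E-side, bench M/L under PUB),
W4 `stub_weightTwoPurity` (route G). UNREGISTERED workfile (W-79: the ideator never registers; the LEAD decides). v1.0 text follows.

# Typed SUB-LEAVES under the weight-two leaf N2 (`K2Leaves.stub_weightTwoControl`, tree `Lines/telescopeK2leaves.lean` v1.0 9a983dad5c46,
# l.207–289) of the research node K2-M♭ of line «telescope», crux 4 `BSDpOnCellC` (stmt-BirchSwinnertonDyer-19034) — ideator bsd-idea-12 g36,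
# crux idea «k2-classical» (v1.0)

UNREGISTERED workfile (W-79: publish-only; the registered skeleton of record is telescope v4 `645c0fbc…`; the LEAD's v6 `57975ee1…` with the
research stub `stub_carrierDivInt` = K2-D♭ is announced). Nothing here is a stub of the registered skeleton; nothing here proves a crux, a
registered stub, or any summit statement. BSD is proved for no curve.

## What this file does (D-0171 — the weight-two leaf decomposed one level further, kernel sorry-free)
N2 says: for EVERY big representation `ρ₂` over `𝒪₂ = ℤ_p⟦X⟧` carrying the fibre data FD of N1, the `𝔭̄`-strict big dual Selmer module
`X₂ = XBig κ ρ₂ 𝔭bar ∅` over `B = ℤ_p⟦X⟧⟦T⟧` satisfies (fg) ∧ (reg₀) ∧ (div₀). Its docstring's prose proof plan is typed here as FOUR sub-leaves in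
MODULE CURRENCY over ONE named auxiliary module — the Pontryagin dual of the weight-two TORSION Selmer group
`Y := Sel_{𝔭̄,∅}(K, M₂[X])^∨ = CharacterModule (TorsionControl.selmer (localMap K) (strictSet p 𝔭bar ∅) (TorsionControl.torsionRep M₂ (C X)))`,
`M₂ = AnticyclotomicBigGaloisRep κ ρ₂` (exactly the right-hand side of the landed `TelescopeK2WeightControl.quotXBig_equiv_dual_selmer_torsion`,
p737740) — and ONE sorry-free kernel of pure module algebra:

* W1 `stub_bigModuleFinite`      [bench M]   (fg): `X₂` is finitely generated over `B` (cofinite generation of `H¹(G_{K,S}, M₂)`, Greenberg 2006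
                                               Prop. 3.2, + inflation; dual of a submodule is a quotient of the dual).
* W2 `stub_weightTwoControlMap`   [bench M/L] weight-two CONTROL in dual form with two-sided defect: a `B`-linear `α : X₂/(C X)X₂ → Y` whose kernel is
                                               killed elementwise by elements prime to `(C X)` (local control defects are `Λ`-cotorsion — INFINITE of
                                               characteristic `~T` at `𝔭̄` in the split-multiplicative exceptional case, zero/`p`-power elsewhere) and
                                               whose cokernel is FINITE (global defect `δ₀(M₂^{Γ_K}/X)`, finite because `E(K_∞)[p^∞]` is;
                                               `finite_ker_torsionInclH1_of_finite_quot` + `exists_quotSMulTop_linearMap_twoSided`, p737740/p737674).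
* W3 `stub_weightTwoTransport`    [bench M/L] the `E`-SIDE at weight two, transported along FD's quasi-isomorphism `θ₀ : A₂[X] → E[p^∞]`: for ANY
                                               compatible `Λ`-structure, `Y` is f.g. torsion over `Λ = ℤ_p⟦T⟧` and `p^e·char_Λ(Y) ⊆ Ch_Λ(X_ac(E/K))`
                                               (`X^{unr}(E) → Y` with `p`-power kernel/cokernel from `θ₀`; `X^{unr}(E) ↠ X_ac = X^{dec}(E)` since
                                               `Sel^{dec} ⊆ Sel^{unr}`; `X_ac(E/K)_{𝔭̄,∅}` f.g. torsion on Cell C: tree `isTorsion_xAc_other_of_cellC` under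
                                               the telescope's PUB facts, `AnticyclotomicDualPair.module_finite_of_finite`).
* W4 `stub_weightTwoPurity`       [research S/M] (pure): `(p^m) ⊆ char_Λ(X₂[C X])` — the clause (pure) of K2-M TOKEN FOR TOKEN (ideator g33's
                                               `Lines/telescopeK2purity.lean`: (pure) ⟸ (sat) + (div) at the `H¹` level; Greenberg 2016 Prop. 4.1.1).
* KERNEL `weightTwoControl_of_subleaves : W1 → W2 → W3 → W4 → N2` (SORRY-FREE; conclusion = N2's statement TOKEN FOR TOKEN): (fg) = W1;
  (reg₀): `X₂/(C X)X₂` is `Λ`-torsion (W2 kernel clause + W3 torsion; `s ≡ φ₀ s (mod C X)` moves `B`-annihilators to `Λ`), then x2-p2 g18's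
  determinant trick `RetractionSpecialization.exists_not_dvd_smul_eq_zero_of_isTorsion_quotSMulTop` (EisensteinPrimesBSDpOnCellCRetractionSpecializationTorsion);
  (div₀): two-sided Herbrand at `X ↦ 0` (`RetractionSpecialization.charIdeal_quotSMulTop_eq_mul_of_retraction`, p729686):
  `char_Λ(X₂/(C X)X₂) = char_Λ(X₂[C X])·φ₀(char_B X₂)`, so W4 gives `p^m·φ₀(char_B X₂) ⊆ char_Λ(X₂/(C X)X₂)`; multiplicativity of `char` in exact
  sequences (`Module.charIdeal_eq_mul_of_exact`) along `α` with `char_Λ(Y/α(·)) = ⊤` (finite ⇒ pseudo-null, `isPseudoNull_of_finite`,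
  `charIdeal_eq_top_of_isPseudoNull`) gives `char_Λ(X₂/(C X)X₂) ⊆ char_Λ(Y)`; W3 gives `p^e·char_Λ(Y) ⊆ Ch_Λ(X_ac)`; hence (div₀) with `j = e + m`.

Degenerate-witness audit: N2 and W1–W4 quantify over ALL `ρ₂` with FD, so `A₂ = 0` is excluded by (fd₀) (a quasi-isomorphism `0 → E[p^∞]` has
infinite cokernel); for `Y = 0` (no weight-two Selmer classes) W3's char clause reads `p^e ∈ Ch_Λ(X_ac(E/K))`, false on Cell C unless `X_ac` is
pseudo-null — W3 is as strong as the road needs and no stronger. W2's kernel clause is implied by, and strictly weaker than, «`ker α` finite»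
(false in the exceptional case). [folklore]

## References
[cite: Greenberg2006, Prop. 3.2] [cite: Castella2018Erratum, Lemma 2.1, §2 (2.5)] [cite: JetchevSkinnerWan2017, Lemma 3.4.1, Thm. 3.3.1]
[cite: Ochiai2006, Prop. 5.1 (p. 1177), Prop. 8.1 (p. 1192)] [cite: Greenberg2016, Prop. 4.1.1] [cite: SkinnerUrban2014, Prop. 3.2.3, Cor. 3.2.9]
[cite: BourbakiAC5to7, VII §4.5 Prop. 10] [cite: GreenbergStevens1993, §2] [cite: Hida1986b, Thm. 2.1] [cite: Delbourgo2008, App. C Thm. C.15]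
-/

set_option autoImplicit false
set_option linter.dupNamespace false

noncomputable section

open scoped Classical MatrixGroups ModularForm

open CongruenceSubgroup WeierstrassCurve NumberField IsDedekindDomain Field PowerSeries
  Literature.NumberTheory.EllipticCurves Literature.NumberTheory.EllipticCurves.GreenbergSelmer
  Literature.NumberTheory.EllipticCurves.ModularForms Literature.NumberTheory.QuadraticFields
  Literature.NumberTheory.EllipticCurves.Rank1Residual
  Literature.NumberTheory.EllipticCurves.Rank1Residual.Typed
  Literature.NumberTheory.EllipticCurves.KrizLi2019
  Literature.NumberTheory.EllipticCurves.GreenbergVatsal2000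
  Literature.NumberTheory.EllipticCurves.Wuthrich2014
  Literature.NumberTheory.EllipticCurves.SteinWuthrich2013
  Literature.NumberTheory.EllipticCurves.Castella2018Exceptional
  Literature.NumberTheory.GaloisRepresentations Literature.NumberTheory.GaloisCohomology
  Literature.NumberTheory.Automorphic
  Summit.BirchSwinnertonDyer.Rank1Residual.X11b.AcSelmer
  Summit.BirchSwinnertonDyer.Rank1Residual.X11b.Halves
  Summit.BirchSwinnertonDyer.Rank1Residual.X11b
  Summit.BirchSwinnertonDyer.Rank1Residual Summit.BirchSwinnertonDyer.Rank1Residual.X1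
  Summit.BirchSwinnertonDyer.Rank1Residual.X2
open Literature.NumberTheory.EllipticCurves.KellerYin2024 (curveLocalLambda)

open Literature.NumberTheory.EllipticCurves.BigGaloisRep

namespace Summit.BirchSwinnertonDyer.BirchSwinnertonDyer.Cruxes.BSDpOnCellC.Telescope.K2Weight2


open Literature.NumberTheory.EllipticCurves.CastellaGrossiLeeSkinner2022 Literature.NumberTheory.EllipticCurves.Castella2018
  Literature.NumberTheory.IwasawaTheory Literature.NumberTheory.IwasawaTheory.Greenberg2016
  Literature.NumberTheory.IwasawaTheory.Greenberg2006
  Summit.BirchSwinnertonDyer.Rank1Residual.X1.KellerYinMuLambdaSplit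
open Literature.NumberTheory.EllipticCurves.KellerYin2024
open Summit.BirchSwinnertonDyer.BirchSwinnertonDyer.Theorems

/-! ## §L The kernel of the retraction `X ↦ 0` (inner variable) is `(C X)` (generic; theorem only) -/

/-- `map constantCoeff G = 0 → C X ∣ G` in `R⟦X⟧⟦T⟧`. [folklore] -/
theorem C_X_dvd_of_map_constantCoeff_eq_zero {R : Type*} [CommRing R] (G : PowerSeries (PowerSeries R))
    (h : PowerSeries.map (PowerSeries.constantCoeff (R := R)) G = 0) :
    PowerSeries.C (PowerSeries.X : PowerSeries R) ∣ G := by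
  refine TelescopeCarrierAlgWOfDivInt.C_dvd_of_forall_dvd_coeff _ _ fun n => ?_
  rw [PowerSeries.X_dvd_iff]
  have h1 := congrArg (PowerSeries.coeff n) h
  rw [PowerSeries.coeff_map, map_zero] at h1
  exact h1

/-! ## §W1 (fg) — cofinite generation: PROVED BY NAME (v1.1; `TelescopeK2WeightTwoFg.bigModuleFinite`, p752319) -/

set_option maxHeartbeats 800000 in
/-- **bigModuleFinite** (W1; v1.1: a THEOREM, formerly `stub_bigModuleFinite`) [CONTENT — bench M, DISCHARGED]. (fg): for every `ρ₂` with FD, `X₂ = XBig κ ρ₂ 𝔭bar ∅` is finitely generated over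
`B = ℤ_p⟦X⟧⟦T⟧` — N2's clause (fg) TOKEN FOR TOKEN. Proof plan: Selmer classes are unramified outside `S = S_p ∪ S₀` ((unr) of FD), so
`Sel ↪ H¹(G_{K,S}, M₂)` by inflation; `M₂ = A₂ ⊗ Λ^*(Ψ⁻¹)` is cofinitely generated over `B` ((tor)/(cof₀): `A₂` cofinitely generated over `𝒪₂`);
Greenberg 2006 Prop. 3.2 (`H^i(G_{K,S}, D)` cofinitely generated for cofinitely generated discrete `D` over a complete Noetherian local ring);
the dual of a submodule is a quotient of the dual; alternatively `TelescopeK2ControlAlgebra.module_finite_characterModule_twoSided` (p737674) from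
the weight-two control map and `Module.Finite Λ Y` (W3) by Nakayama (`B` is `(C X)`-adically complete, `X₂` is `(C X)`-adically separated by (tor)).
Why it might fail: only if FD's (unr) were dropped (infinitely many ramified primes); as typed it is printed material.
Sources: [cite: Greenberg2006, Prop. 3.2] [cite: GreenbergLNM1716, Prop. 3.2, §4] [cite: SkinnerUrban2014, Lemma 3.2.6] -/
theorem bigModuleFinite :
    ∀ (W : WeierstrassCurve ℚ) [W.IsElliptic] [W.IsGloballyMinimal] (p : ℕ) [Fact p.Prime],
    ∀ (N : ℕ) [NeZero N] (K : Type) [Field K] [NumberField K] (Dt : ModularParametrizationData W N)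
      (H : HeegnerDatum N (NumberField.discr K)) (ιK : K →+* ℂ) (P : (W.baseChange K).toAffine.Point),
      CellC W p → W.conductorNorm ℤ = N →
      IsImaginaryQuadratic K → NumberField.discr K < -4 → SatisfiesHeegnerHypothesis N K →
      (W.quadraticTwist (NumberField.discr K : ℚ)).entireLFunction 1 ≠ 0 →
      WeierstrassCurve.Affine.Point.map ιK.toRatAlgHom P = heegnerPointComplex Dt H →
      ¬ (p : ℤ) ∣ Dt.c → ¬ IsOfFinAddOrder P →
      Odd (NumberField.discr K) →
      ∀ (κ : ZpExtension K p), κ.IsAnticyclotomic →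
        ∀ (γ : Field.absoluteGaloisGroup K) [Fact (κ.IsTopGenerator γ)]
          (𝔭 : HeightOneSpectrum (𝓞 K)), ((p : ℕ) : 𝓞 K) ∈ 𝔭.asIdeal →
          𝔭.asIdeal.ramificationIdx (𝓞 ℚ) = 1 → 𝔭.asIdeal.inertiaDeg (𝓞 ℚ) = 1 →
          ∀ (𝔭bar : HeightOneSpectrum (𝓞 K)), ((p : ℕ) : 𝓞 K) ∈ 𝔭bar.asIdeal → 𝔭bar ≠ 𝔭 →
            ((Ideal.span {(p : ℤ)}).primesOver (𝓞 K)).ncard = 2 →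
          ∀ (f : CuspForm (CongruenceSubgroup.Gamma0 N) 2), IsNewformOf W f →
            ∀ (ι' : PadicAlgCl p ≃+* ℂ),
              (∀ (w : InfinitePlace K) (k : 𝓞 K),
                k ∈ 𝔭.asIdeal ↔ ‖ι'.symm (w.embedding (k : K))‖ < 1) →
              ∀ (ΩK : ℂ) (Ωp : ℂ_[p]) (Q : PowerSeries 𝓞_ℂ_[p]), ΩK ≠ 0 → ‖Ωp‖ = 1 →
                R1.IsBDPLFunctionInt p ι' 𝔭 κ γ f ΩK Ωp Q →
      ∀ (L : PowerSeries (PowerSeries (unrIntegers p))) (x : ℕ → ℤ_[p]) (D : ℕ → Skinner2016.HidaCongruentForm W p 1),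
        (∀ k, ‖x k‖ < 1) ∧ Filter.Tendsto x Filter.atTop (nhds 0) ∧
        (∃ e : ℕ, PowerSeries.C ((p : 𝓞_ℂ_[p]) ^ e) * Q ∈
          Ideal.span {PowerSeries.map (R1.unrToCpInt p) (PowerSeries.map (PowerSeries.constantCoeff (R := unrIntegers p)) L)}) ∧
        (∀ k : ℕ, (∀ y : coeffField (D k).g, ι' ((D k).ι y) = (y : ℂ)) ∧ 2 * ((p : ℤ) - 1) ∣ (D k).k - 2 ∧
          ∃ (ΩKg : ℂ) (Ωpg : ℂ_[p]) (Lg : UnrSeries p), ΩKg ≠ 0 ∧ ‖Ωpg‖ = 1 ∧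
            IsBDPLFunctionWt ι' 𝔭 κ γ (D k).g ΩKg Ωpg Lg ∧
          ∃ Ψ : UnrSeries p,
            (∃ U : PowerSeries (PowerSeries (unrIntegers p)),
              PowerSeries.map (PowerSeries.C (R := unrIntegers p)) Ψ =
                L + PowerSeries.C (PowerSeries.X - PowerSeries.C (toUnr p (x k))) * U) ∧
            (∃ e : ℕ, PowerSeries.C ((p : 𝓞_ℂ_[p]) ^ e) * PowerSeries.map (R1.unrToCpInt p) Ψ ∈
              Ideal.span {PowerSeries.map (R1.unrToCpInt p) Lg})) ∧
        (∃ A : ℕ → UnrSeries p, ∀ ℓ : ℕ, ℓ.Prime → ¬ ℓ ∣ N →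
          (∃ U : UnrSeries p, A ℓ = PowerSeries.C (toUnr p ((W.frobeniusTrace ℓ : ℤ) : ℤ_[p])) + PowerSeries.X * U) ∧
          ∀ k : ℕ, ∃ (c : unrIntegers p) (U : UnrSeries p),
            A ℓ = PowerSeries.C c + (PowerSeries.X - PowerSeries.C (toUnr p (x k))) * U ∧
            ((c : ℂ_[p]) = algebraMap (PadicAlgCl p) ℂ_[p]
              ((D k).ι ⟨(UpperHalfPlane.qExpansion 1 ⇑(D k).g).coeff ℓ, coeff_mem_coeffField (D k).g ℓ⟩))) →
      ∀ [TopologicalSpace (PowerSeries ℤ_[p])] (A₂ : Type) [AddCommGroup A₂]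
        [Module (PowerSeries ℤ_[p]) A₂] [TopologicalSpace A₂] [DiscreteTopology A₂]
        (ρ₂ : ContinuousRep (Field.absoluteGaloisGroup K) (PowerSeries ℤ_[p]) A₂)
        [TopologicalSpace (PowerSeries (PowerSeries ℤ_[p]))]
        [ContinuousSMul (PowerSeries (PowerSeries ℤ_[p])) (BigRepModule (PowerSeries ℤ_[p]) p A₂)]
        [Module (PowerSeries ℤ_[p]) (XBig κ ρ₂ 𝔭bar (∅ : Set (HeightOneSpectrum (𝓞 K))))]
        [IsScalarTower (PowerSeries ℤ_[p]) (PowerSeries (PowerSeries ℤ_[p]))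
          (XBig κ ρ₂ 𝔭bar (∅ : Set (HeightOneSpectrum (𝓞 K))))],
        ((∀ a : A₂, ∃ n : ℕ, (PowerSeries.X : PowerSeries ℤ_[p]) ^ n • a = 0) ∧
          (∀ a : A₂, ∃ b : A₂, (PowerSeries.X : PowerSeries ℤ_[p]) • b = a) ∧
          (∀ (k : ℕ) (a : A₂), ∃ b : A₂, (PowerSeries.X - PowerSeries.C (x k)) • b = a) ∧
          (∃ S₀ : Set (HeightOneSpectrum (𝓞 K)), S₀.Finite ∧ GaloisRep.IsUnramifiedOutside S₀ ρ₂) ∧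
          (∃ θ₀ : Submodule.torsionBy (PowerSeries ℤ_[p]) A₂ (PowerSeries.X : PowerSeries ℤ_[p]) →+
              PrimaryTorsion (W.baseChange K).geomPoints p,
            (∀ (c : ℤ_[p]) (a : Submodule.torsionBy (PowerSeries ℤ_[p]) A₂ (PowerSeries.X : PowerSeries ℤ_[p])),
                θ₀ (PowerSeries.C c • a) = c • θ₀ a) ∧
            (∀ (σ : Field.absoluteGaloisGroup K)
                (a : Submodule.torsionBy (PowerSeries ℤ_[p]) A₂ (PowerSeries.X : PowerSeries ℤ_[p])),
                θ₀ (BigGaloisRep.torsionRep ρ₂ (PowerSeries.X : PowerSeries ℤ_[p]) σ a) =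
                  (W.baseChange K).primaryTorsionGaloisRep p σ (θ₀ a)) ∧
            Finite θ₀.ker ∧ Finite (PrimaryTorsion (W.baseChange K).geomPoints p ⧸ θ₀.range)) ∧
          (∀ k : ℕ, Function.Surjective (algebraMap ℤ_[p] (padicCoeffIntegers (D k).ι)) ∧
            ∃ θ : Submodule.torsionBy (PowerSeries ℤ_[p]) A₂ (PowerSeries.X - PowerSeries.C (x k)) →+
                Cofree (D k).Δ.selfDualRep (padicCoeffField (D k).ι),
              (∀ (c : ℤ_[p])
                  (a : Submodule.torsionBy (PowerSeries ℤ_[p]) A₂ (PowerSeries.X - PowerSeries.C (x k))),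
                  θ (PowerSeries.C c • a) = algebraMap ℤ_[p] (padicCoeffIntegers (D k).ι) c • θ a) ∧
              (∀ (σ : Field.absoluteGaloisGroup K)
                  (a : Submodule.torsionBy (PowerSeries ℤ_[p]) A₂ (PowerSeries.X - PowerSeries.C (x k))),
                  θ (BigGaloisRep.torsionRep ρ₂ (PowerSeries.X - PowerSeries.C (x k)) σ a) =
                    (D k).Δ.selfDualCofreeRepOver K σ (θ a)) ∧
              Finite θ.ker ∧ Finite (Cofree (D k).Δ.selfDualRep (padicCoeffField (D k).ι) ⧸ θ.range))) →
        Module.Finite (PowerSeries (PowerSeries ℤ_[p])) (XBig κ ρ₂ 𝔭bar (∅ : Set (HeightOneSpectrum (𝓞 K)))) :=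
  TelescopeK2WeightTwoFg.bigModuleFinite

/-! ## §W2 Weight-two control map with two-sided defect, dual form (bench M/L) -/

set_option maxHeartbeats 800000 in
/-- **stub_weightTwoControlMap** (W2) [CONTENT — bench M/L; weight-two control with two-sided defect, dual form]. For every `ρ₂` with FD there is a
`B`-linear map `α : X₂/(C X)X₂ → Y = Sel_{𝔭̄,∅}(K, M₂[C X])^∨` whose KERNEL is killed elementwise by elements prime to `(C X)` (i.e. is `Λ`-torsion)
and whose COKERNEL is finite. Proof plan (by name): `X₂/(C X)X₂ ≃ (Sel(M₂)[C X])^∨` (tree `PontryaginCongruence.nonempty_quotSMulTop_equiv_dual_torsionBy`,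
no hypothesis); `α :=` the dual of the control map `θ_X : Sel(M₂[C X]) → Sel(M₂)[C X]` (restriction of `H¹(ι_X)`; `TelescopeK2ControlAlgebra.
exists_quotSMulTop_linearMap_twoSided`, p737674); `coker α = (ker θ_X)^∨` is finite by `TelescopeK2WeightControl.finite_ker_torsionInclH1_of_finite_quot`
(p737740) once `M₂^{Γ_K}/X·M₂^{Γ_K}` is finite (⟸ `A₂(K_∞)[X] ≈ E(K_∞)[p^∞]` finite via (fd₀); Shapiro); `ker α = (coker θ_X)^∨ ↪ (local defects)^∨`,
and each local defect `M₂^{G_v}/X` (`v = 𝔭̄`; `I_w`, `w ∤ p`) is `Λ`-cotorsion: zero for `w ∉ S₀` ((cof₀)+(unr)), `p`-power at `w ∈ S₀` when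
`A₂^{I_w}` is `𝒪₂`-cofree (constant inertia type along the branch), and at `𝔭̄` finite except in the split-multiplicative exceptional case where it is
`≈ (ℤ_p⟦X⟧/(a_p(X) − 1))^∨`-shaped of characteristic `~((1+T)^{p^t} − 1)` — infinite but cotorsion (exact control `quotXBig_equiv_dual_selmer_torsion`
is the defect-free special case). In print this is Ochiai 2006 Prop. 5.1 (Compositio 142 p. 1177: `res_J : Sel_J → Sel_T[J]` at a height-one
`J`, `Coker(res_J)` a subquotient of `L_J = (F⁻A[…]_J)^{G_{ℚ_p}} ⊕ ⨁_{v ∈ Σ∖{p,∞}} ((A^{I_v})_J)^{G_{ℚ_v}}`; «the assertions on Coker hold without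
Condition (Ir); the assertion on Ker might be modified» — here: finite instead of zero) and Delbourgo 2008 App. C Thm. C.15.
Why it might fail: a local defect that is NOT `Λ`-cotorsion — at a prime `w ∈ S₀`, `w ∤ p`, where `A₂^{I_w}` has an `(𝒪₂/(X·g))^∨` piece (inertia
invariants of the weight-two fibre not lifting to the branch) AND `w` splits completely in `K_∞` (excluded here: every `w ∣ N` splits in `K` by the
Heegner hypothesis, hence is finitely decomposed in the anticyclotomic tower, so the defect is co-induced from an open subgroup and cotorsion).
Sources: [cite: Ochiai2006, Prop. 5.1 (p. 1177)] [cite: Castella2018Erratum, Lemma 2.1] [cite: JetchevSkinnerWan2017, Lemma 3.4.1] [cite: Delbourgo2008, App. C Thm. C.15]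
[cite: GreenbergLNM1716, §4 Prop. 4.10] -/
theorem stub_weightTwoControlMap :
    ∀ (W : WeierstrassCurve ℚ) [W.IsElliptic] [W.IsGloballyMinimal] (p : ℕ) [Fact p.Prime],
    ∀ (N : ℕ) [NeZero N] (K : Type) [Field K] [NumberField K] (Dt : ModularParametrizationData W N)
      (H : HeegnerDatum N (NumberField.discr K)) (ιK : K →+* ℂ) (P : (W.baseChange K).toAffine.Point),
      CellC W p → W.conductorNorm ℤ = N →
      IsImaginaryQuadratic K → NumberField.discr K < -4 → SatisfiesHeegnerHypothesis N K →
      (W.quadraticTwist (NumberField.discr K : ℚ)).entireLFunction 1 ≠ 0 →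
      WeierstrassCurve.Affine.Point.map ιK.toRatAlgHom P = heegnerPointComplex Dt H →
      ¬ (p : ℤ) ∣ Dt.c → ¬ IsOfFinAddOrder P →
      Odd (NumberField.discr K) →
      ∀ (κ : ZpExtension K p), κ.IsAnticyclotomic →
        ∀ (γ : Field.absoluteGaloisGroup K) [Fact (κ.IsTopGenerator γ)]
          (𝔭 : HeightOneSpectrum (𝓞 K)), ((p : ℕ) : 𝓞 K) ∈ 𝔭.asIdeal →
          𝔭.asIdeal.ramificationIdx (𝓞 ℚ) = 1 → 𝔭.asIdeal.inertiaDeg (𝓞 ℚ) = 1 →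
          ∀ (𝔭bar : HeightOneSpectrum (𝓞 K)), ((p : ℕ) : 𝓞 K) ∈ 𝔭bar.asIdeal → 𝔭bar ≠ 𝔭 →
            ((Ideal.span {(p : ℤ)}).primesOver (𝓞 K)).ncard = 2 →
          ∀ (f : CuspForm (CongruenceSubgroup.Gamma0 N) 2), IsNewformOf W f →
            ∀ (ι' : PadicAlgCl p ≃+* ℂ),
              (∀ (w : InfinitePlace K) (k : 𝓞 K),
                k ∈ 𝔭.asIdeal ↔ ‖ι'.symm (w.embedding (k : K))‖ < 1) →
              ∀ (ΩK : ℂ) (Ωp : ℂ_[p]) (Q : PowerSeries 𝓞_ℂ_[p]), ΩK ≠ 0 → ‖Ωp‖ = 1 →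
                R1.IsBDPLFunctionInt p ι' 𝔭 κ γ f ΩK Ωp Q →
      ∀ (L : PowerSeries (PowerSeries (unrIntegers p))) (x : ℕ → ℤ_[p]) (D : ℕ → Skinner2016.HidaCongruentForm W p 1),
        (∀ k, ‖x k‖ < 1) ∧ Filter.Tendsto x Filter.atTop (nhds 0) ∧
        (∃ e : ℕ, PowerSeries.C ((p : 𝓞_ℂ_[p]) ^ e) * Q ∈
          Ideal.span {PowerSeries.map (R1.unrToCpInt p) (PowerSeries.map (PowerSeries.constantCoeff (R := unrIntegers p)) L)}) ∧
        (∀ k : ℕ, (∀ y : coeffField (D k).g, ι' ((D k).ι y) = (y : ℂ)) ∧ 2 * ((p : ℤ) - 1) ∣ (D k).k - 2 ∧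
          ∃ (ΩKg : ℂ) (Ωpg : ℂ_[p]) (Lg : UnrSeries p), ΩKg ≠ 0 ∧ ‖Ωpg‖ = 1 ∧
            IsBDPLFunctionWt ι' 𝔭 κ γ (D k).g ΩKg Ωpg Lg ∧
          ∃ Ψ : UnrSeries p,
            (∃ U : PowerSeries (PowerSeries (unrIntegers p)),
              PowerSeries.map (PowerSeries.C (R := unrIntegers p)) Ψ =
                L + PowerSeries.C (PowerSeries.X - PowerSeries.C (toUnr p (x k))) * U) ∧
            (∃ e : ℕ, PowerSeries.C ((p : 𝓞_ℂ_[p]) ^ e) * PowerSeries.map (R1.unrToCpInt p) Ψ ∈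
              Ideal.span {PowerSeries.map (R1.unrToCpInt p) Lg})) ∧
        (∃ A : ℕ → UnrSeries p, ∀ ℓ : ℕ, ℓ.Prime → ¬ ℓ ∣ N →
          (∃ U : UnrSeries p, A ℓ = PowerSeries.C (toUnr p ((W.frobeniusTrace ℓ : ℤ) : ℤ_[p])) + PowerSeries.X * U) ∧
          ∀ k : ℕ, ∃ (c : unrIntegers p) (U : UnrSeries p),
            A ℓ = PowerSeries.C c + (PowerSeries.X - PowerSeries.C (toUnr p (x k))) * U ∧
            ((c : ℂ_[p]) = algebraMap (PadicAlgCl p) ℂ_[p]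
              ((D k).ι ⟨(UpperHalfPlane.qExpansion 1 ⇑(D k).g).coeff ℓ, coeff_mem_coeffField (D k).g ℓ⟩))) →
      ∀ [TopologicalSpace (PowerSeries ℤ_[p])] (A₂ : Type) [AddCommGroup A₂]
        [Module (PowerSeries ℤ_[p]) A₂] [TopologicalSpace A₂] [DiscreteTopology A₂]
        (ρ₂ : ContinuousRep (Field.absoluteGaloisGroup K) (PowerSeries ℤ_[p]) A₂)
        [TopologicalSpace (PowerSeries (PowerSeries ℤ_[p]))]
        [ContinuousSMul (PowerSeries (PowerSeries ℤ_[p])) (BigRepModule (PowerSeries ℤ_[p]) p A₂)]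
        [Module (PowerSeries ℤ_[p]) (XBig κ ρ₂ 𝔭bar (∅ : Set (HeightOneSpectrum (𝓞 K))))]
        [IsScalarTower (PowerSeries ℤ_[p]) (PowerSeries (PowerSeries ℤ_[p]))
          (XBig κ ρ₂ 𝔭bar (∅ : Set (HeightOneSpectrum (𝓞 K))))],
        ((∀ a : A₂, ∃ n : ℕ, (PowerSeries.X : PowerSeries ℤ_[p]) ^ n • a = 0) ∧
          (∀ a : A₂, ∃ b : A₂, (PowerSeries.X : PowerSeries ℤ_[p]) • b = a) ∧
          (∀ (k : ℕ) (a : A₂), ∃ b : A₂, (PowerSeries.X - PowerSeries.C (x k)) • b = a) ∧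
          (∃ S₀ : Set (HeightOneSpectrum (𝓞 K)), S₀.Finite ∧ GaloisRep.IsUnramifiedOutside S₀ ρ₂) ∧
          (∃ θ₀ : Submodule.torsionBy (PowerSeries ℤ_[p]) A₂ (PowerSeries.X : PowerSeries ℤ_[p]) →+
              PrimaryTorsion (W.baseChange K).geomPoints p,
            (∀ (c : ℤ_[p]) (a : Submodule.torsionBy (PowerSeries ℤ_[p]) A₂ (PowerSeries.X : PowerSeries ℤ_[p])),
                θ₀ (PowerSeries.C c • a) = c • θ₀ a) ∧
            (∀ (σ : Field.absoluteGaloisGroup K)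
                (a : Submodule.torsionBy (PowerSeries ℤ_[p]) A₂ (PowerSeries.X : PowerSeries ℤ_[p])),
                θ₀ (BigGaloisRep.torsionRep ρ₂ (PowerSeries.X : PowerSeries ℤ_[p]) σ a) =
                  (W.baseChange K).primaryTorsionGaloisRep p σ (θ₀ a)) ∧
            Finite θ₀.ker ∧ Finite (PrimaryTorsion (W.baseChange K).geomPoints p ⧸ θ₀.range)) ∧
          (∀ k : ℕ, Function.Surjective (algebraMap ℤ_[p] (padicCoeffIntegers (D k).ι)) ∧
            ∃ θ : Submodule.torsionBy (PowerSeries ℤ_[p]) A₂ (PowerSeries.X - PowerSeries.C (x k)) →+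
                Cofree (D k).Δ.selfDualRep (padicCoeffField (D k).ι),
              (∀ (c : ℤ_[p])
                  (a : Submodule.torsionBy (PowerSeries ℤ_[p]) A₂ (PowerSeries.X - PowerSeries.C (x k))),
                  θ (PowerSeries.C c • a) = algebraMap ℤ_[p] (padicCoeffIntegers (D k).ι) c • θ a) ∧
              (∀ (σ : Field.absoluteGaloisGroup K)
                  (a : Submodule.torsionBy (PowerSeries ℤ_[p]) A₂ (PowerSeries.X - PowerSeries.C (x k))),
                  θ (BigGaloisRep.torsionRep ρ₂ (PowerSeries.X - PowerSeries.C (x k)) σ a) =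
                    (D k).Δ.selfDualCofreeRepOver K σ (θ a)) ∧
              Finite θ.ker ∧ Finite (Cofree (D k).Δ.selfDualRep (padicCoeffField (D k).ι) ⧸ θ.range))) →
        ∃ α : QuotSMulTop (PowerSeries.C (PowerSeries.X : PowerSeries ℤ_[p])) (XBig κ ρ₂ 𝔭bar (∅ : Set (HeightOneSpectrum (𝓞 K)))) →ₗ[PowerSeries (PowerSeries ℤ_[p])]
          (CharacterModule (TorsionControl.selmer (localMap K) (strictSet p 𝔭bar (∅ : Set (HeightOneSpectrum (𝓞 K))))
            (TorsionControl.torsionRep (AnticyclotomicBigGaloisRep κ ρ₂) (PowerSeries.C (PowerSeries.X : PowerSeries ℤ_[p]))))),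
          (∀ m ∈ LinearMap.ker α, ∃ s : PowerSeries (PowerSeries ℤ_[p]),
            ¬ ((PowerSeries.C (PowerSeries.X : PowerSeries ℤ_[p])) ∣ s) ∧ s • m = 0) ∧
          Finite ((CharacterModule (TorsionControl.selmer (localMap K) (strictSet p 𝔭bar (∅ : Set (HeightOneSpectrum (𝓞 K))))
            (TorsionControl.torsionRep (AnticyclotomicBigGaloisRep κ ρ₂) (PowerSeries.C (PowerSeries.X : PowerSeries ℤ_[p]))))) ⧸ LinearMap.range α) := by
  sorry

/-! ## §W3 The `E`-side at weight two: STUB `stub_ESideOfPub : (PUB) → (I-E)` (bench M/L, LEAD) and W3 := transport of (I-E), BY NAME (v1.1) -/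

set_option maxHeartbeats 800000 in
/-- **stub_ESideOfPub** (v1.1; replaces `stub_weightTwoTransport` as the open E-side content) [CONTENT — bench M/L; the LEAD cruxlead-19034
g3's input (I-E) of `weightTwoTransport_of_inputs`, its `hE` binder TOKEN FOR TOKEN, prefixed by the v10 cite stub `stub_publishedFacts` text]:
under the refereed named facts, for the road-R-β prefix through `((p).primesOver (𝓞 K)).ncard = 2` and every topology on `Λ = ℤ_p⟦T⟧` making
`E[p^∞] ⊗ Λ^*` a topological module, the UNRAMIFIED big Selmer dual `XBig κ ((W.baseChange K).primaryTorsionGaloisRep p) 𝔭̄ ∅` is finitely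
generated and torsion over `Λ`. Proof plan (LEAD, STATUS 23:28:23Z / OfInputs docstring): `X_ac(E/K_∞)` is `Λ`-torsion on Cell C
(`isTorsion_xAc_other_of_cellC`, which consumes GZK `rank_eq_analyticRank_of_analyticRank_le_one` + `exists_isNewformOf` of PUB — the reason
for the `(PUB) →` prefix, LEAD FINDING 23:31:06Z) ≃ `X^{dec,∅}` (Shapiro, `nonempty_linearEquiv_XAc_XBigDecomp`); Σ-change at `w ∣ N`
(`BigGaloisRep.XBigDecomp.isTorsion_and_charIdeal_mul_span_prod_le` + local terms); `ℋ^{ur}_w = 0` at good `w ∤ Np`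
(`Castella2018.resH1_localMap_inl_eq_zero_of_inr`); finite generation by `TelescopeK2SelmerCofinite.module_finite_XBig` (p748332).
Why it might fail: bench-grade; the local terms at `w ∣ N` for the TRIVIAL-character big representation need `p`-power control of
`H¹(I_w, E[p^∞] ⊗ Λ^*)^{Frob}` (finite for multiplicative / additive `w`; printed: Greenberg LNM 1716 §2, Lemma 2.2–2.3).
Sources: [cite: GreenbergLNM1716, §2 Lemma 2.2–2.3, §4] [cite: SkinnerUrban2014, Prop. 3.2.3, §3.1.6] [cite: Castella2018, Def. 2.2]
(v1.0 docstring of the former stub, for the record:) **stub_weightTwoTransport** (W3) [CONTENT — bench M/L; the `E`-side at weight two]. For every `ρ₂` with FD and every `Λ = ℤ_p⟦T⟧`-structure on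
`Y = Sel_{𝔭̄,∅}(K, M₂[C X])^∨` compatible with its `B`-structure: `Y` is finitely generated and torsion over `Λ`, and `p^e·char_Λ(Y) ⊆ Ch_Λ(X_ac(E/K)_{𝔭̄,∅})`
for some `e`. Proof plan: (fd₀)'s equivariant quasi-isomorphism `θ₀ : A₂[X] → E[p^∞]` (finite kernel `F₁`, finite cokernel `F₂`) induces
`M₂[C X] = A₂[X] ⊗ Λ^*(Ψ⁻¹) → E[p^∞] ⊗ Λ^*(Ψ⁻¹)` with kernel/cokernel `Fᵢ ⊗ Λ^*` (cofinitely generated, killed by `#Fᵢ`), hence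
`c : Sel_{𝔭̄,∅}(K, M₂[C X]) → Sel^{unr}_{𝔭̄,∅}(K, E[p^∞] ⊗ Λ^*)` with kernel and cokernel killed by a power of `p` (long exact sequences; local conditions
strict at `𝔭̄`, unramified at `w ∤ p` on both sides); dually `β : X^{unr}(E) → Y` with `p`-power-killed f.g. kernel and cokernel, so
`p^{e₁}·char_Λ(Y) ⊆ char_Λ(X^{unr}(E))` (`charIdeal_eq_mul_of_exact` twice, `exists_span_pow_le_charIdeal_of_isTorsionBy`); `Sel^{dec} ⊆ Sel^{unr}`
dualises to `X^{unr}(E) ↠ X^{dec}(E) ≃ X_ac(E/K)_{𝔭̄,∅}` (tree `nonempty_linearEquiv_XAc_XBigDecomp`, Skinner–Urban Prop. 3.2.3), so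
`char_Λ(X^{unr}(E)) ⊆ Ch_Λ(X_ac)`; `X^{unr}(E)/…` differs from `X^{dec}(E)` by `⊕_{w ∣ N} H¹_ur(K_w, E[p^∞] ⊗ Λ^*)^∨`, `p`-power torsion (Tamagawa
`p`-parts), so `X^{unr}(E)` is f.g. torsion because `X_ac(E/K)_{𝔭̄,∅}` is (Cell C: tree `isTorsion_xAc_other_of_cellC` under the telescope's PUB facts
`stub_publishedFacts` — GZK, modularity, Poitou–Tate ×2 — and `AnticyclotomicDualPair.module_finite_of_finite`); f.g./torsion of `Y` follow along `β`.
Why it might fail: the identification of the TREE's `X_ac` (`Castella2018.AcSelmer.XAc`, Def. 2.2 strict set, `Λ`-action through `γ`) with the dual of the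
big-module Selmer group is in the tree only for `E`'s own representation (`nonempty_linearEquiv_XAc_XBigDecomp`); the unramified-vs-strict discrepancy at
`w ∣ N` must be `p`-power torsion (it is: `w` split in `K`, `E[p^∞]^{I_w}/(Frob_w − 1)` finite); Cell C allows `p = 3` where nothing changes here.
Sources: [cite: SkinnerUrban2014, Prop. 3.2.3, Lemma 3.2.6] [cite: Castella2018, Def. 2.2, Thm. 2.3] [cite: JetchevSkinnerWan2017, Thm. 3.3.1]
[cite: GreenbergLNM1716, §4] [cite: Castella2018Erratum, §2] -/
theorem stub_ESideOfPub :
    (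
    ((((lambdaMu_multiplicative_of_gvPar ∧ thm16_charIdeal_dvd_multiplicative_of_reducible ∧
    thm61_splitMultiplicative ∧ thm61_nonsplitMultiplicative ∧
    (∀ (W : WeierstrassCurve ℚ) [W.IsElliptic] [W.IsGloballyMinimal] (p : ℕ) [Fact p.Prime],
      greenberg_stevens (W := W) (p := p)) ∧
    exists_isNewformOf ∧
    hsieh2014_exists_anticyclotomicPAdicLFunction ∧
    (∀ (N : ℕ) [NeZero N] (W : WeierstrassCurve ℚ) (K : Type) [Field K] [NumberField K],
      gross_zagier N W K) ∧
    (∀ (N : ℕ) [NeZero N] (W : WeierstrassCurve ℚ) (K : Type) [Field K] [NumberField K],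
      kolyvagin N W K) ∧
    rank_eq_analyticRank_of_analyticRank_le_one ∧ HoffsteinLuo1997_exists_twist_L_one_ne_zero ∧
    mazur_not_dvd_maninConstant_of_odd ∧ bsdRHS_eq_of_isIsogenous) ∧
    thm210_thm211_bdpDisplay_pNew) ∧
    LiuZhangZhang2018.thm151_thm153_modularCurve_heegnerVector) ∧
    (prop125_characterGrSelmerDual_torsion_muZero_dim ∧
      cor126_residualCharacter_globalLift ∧ cor126_residualCharacter_localSurjective ∧
      thm212_exists_isKatzLFunction ∧
      Literature.NumberTheory.EllipticCurves.Castella2018.cas20_thm211_memberForms_sigmaFrames_congr)) ∧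
      Literature.NumberTheory.EllipticCurves.BCGKPST2020.thm331_rubin_exists_katzMeasure₂_pseudoIso_span_eq ∧
      Literature.NumberTheory.EllipticCurves.DeShalit1987.thmII64_katzMeasure₂_functionalEquation ∧
      Literature.NumberTheory.EllipticCurves.Hida2010MuInvariant.thmI_mu_katzBranch_reflect_eq_zero) →
    ∀ (W : WeierstrassCurve ℚ) [W.IsElliptic] [W.IsGloballyMinimal] (p : ℕ) [Fact p.Prime],
    ∀ (N : ℕ) [NeZero N] (K : Type) [Field K] [NumberField K] (Dt : ModularParametrizationData W N)
      (H : HeegnerDatum N (NumberField.discr K)) (ιK : K →+* ℂ) (P : (W.baseChange K).toAffine.Point),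
      CellC W p → W.conductorNorm ℤ = N →
      IsImaginaryQuadratic K → NumberField.discr K < -4 → SatisfiesHeegnerHypothesis N K →
      (W.quadraticTwist (NumberField.discr K : ℚ)).entireLFunction 1 ≠ 0 →
      WeierstrassCurve.Affine.Point.map ιK.toRatAlgHom P = heegnerPointComplex Dt H →
      ¬ (p : ℤ) ∣ Dt.c → ¬ IsOfFinAddOrder P →
      Odd (NumberField.discr K) →
      ∀ (κ : ZpExtension K p), κ.IsAnticyclotomic →
        ∀ (γ : Field.absoluteGaloisGroup K) [Fact (κ.IsTopGenerator γ)]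
          (𝔭 : HeightOneSpectrum (𝓞 K)), ((p : ℕ) : 𝓞 K) ∈ 𝔭.asIdeal →
          𝔭.asIdeal.ramificationIdx (𝓞 ℚ) = 1 → 𝔭.asIdeal.inertiaDeg (𝓞 ℚ) = 1 →
          ∀ (𝔭bar : HeightOneSpectrum (𝓞 K)), ((p : ℕ) : 𝓞 K) ∈ 𝔭bar.asIdeal → 𝔭bar ≠ 𝔭 →
            ((Ideal.span {(p : ℤ)}).primesOver (𝓞 K)).ncard = 2 →
          ∀ [TopologicalSpace (PowerSeries ℤ_[p])]
            [ContinuousSMul (PowerSeries ℤ_[p])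
              (BigRepModule ℤ_[p] p (PrimaryTorsion (W.baseChange K).geomPoints p))],
            Module.Finite (PowerSeries ℤ_[p])
                (XBig κ ((W.baseChange K).primaryTorsionGaloisRep p) 𝔭bar (∅ : Set (HeightOneSpectrum (𝓞 K)))) ∧
              Module.IsTorsion (PowerSeries ℤ_[p])
                (XBig κ ((W.baseChange K).primaryTorsionGaloisRep p) 𝔭bar (∅ : Set (HeightOneSpectrum (𝓞 K)))) := by
  sorry

set_option maxHeartbeats 1600000 in
/-- **W3 from the E-side input, by name** (v1.1; formerly the stub `stub_weightTwoTransport`): the LEAD's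
`TelescopeK2WeightTwoTransportOfInputs.weightTwoTransport_of_inputs` (p751200) with (W3-fg) discharged (`TelescopeK2WeightTwoFg.weightTwoFg`,
p752319) — `TelescopeK2WeightTwoFg.weightTwoTransport_of_E`. Conclusion = v1.0's `stub_weightTwoTransport` text TOKEN FOR TOKEN.
[cite: GreenbergLNM1716, §4] [cite: SkinnerUrban2014, Prop. 3.2.3] -/
theorem weightTwoTransport_of_ESide
    (hE :
    ∀ (W : WeierstrassCurve ℚ) [W.IsElliptic] [W.IsGloballyMinimal] (p : ℕ) [Fact p.Prime],
    ∀ (N : ℕ) [NeZero N] (K : Type) [Field K] [NumberField K] (Dt : ModularParametrizationData W N)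
      (H : HeegnerDatum N (NumberField.discr K)) (ιK : K →+* ℂ) (P : (W.baseChange K).toAffine.Point),
      CellC W p → W.conductorNorm ℤ = N →
      IsImaginaryQuadratic K → NumberField.discr K < -4 → SatisfiesHeegnerHypothesis N K →
      (W.quadraticTwist (NumberField.discr K : ℚ)).entireLFunction 1 ≠ 0 →
      WeierstrassCurve.Affine.Point.map ιK.toRatAlgHom P = heegnerPointComplex Dt H →
      ¬ (p : ℤ) ∣ Dt.c → ¬ IsOfFinAddOrder P →
      Odd (NumberField.discr K) →
      ∀ (κ : ZpExtension K p), κ.IsAnticyclotomic →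
        ∀ (γ : Field.absoluteGaloisGroup K) [Fact (κ.IsTopGenerator γ)]
          (𝔭 : HeightOneSpectrum (𝓞 K)), ((p : ℕ) : 𝓞 K) ∈ 𝔭.asIdeal →
          𝔭.asIdeal.ramificationIdx (𝓞 ℚ) = 1 → 𝔭.asIdeal.inertiaDeg (𝓞 ℚ) = 1 →
          ∀ (𝔭bar : HeightOneSpectrum (𝓞 K)), ((p : ℕ) : 𝓞 K) ∈ 𝔭bar.asIdeal → 𝔭bar ≠ 𝔭 →
            ((Ideal.span {(p : ℤ)}).primesOver (𝓞 K)).ncard = 2 →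
          ∀ [TopologicalSpace (PowerSeries ℤ_[p])]
            [ContinuousSMul (PowerSeries ℤ_[p])
              (BigRepModule ℤ_[p] p (PrimaryTorsion (W.baseChange K).geomPoints p))],
            Module.Finite (PowerSeries ℤ_[p])
                (XBig κ ((W.baseChange K).primaryTorsionGaloisRep p) 𝔭bar (∅ : Set (HeightOneSpectrum (𝓞 K)))) ∧
              Module.IsTorsion (PowerSeries ℤ_[p])
                (XBig κ ((W.baseChange K).primaryTorsionGaloisRep p) 𝔭bar (∅ : Set (HeightOneSpectrum (𝓞 K))))) :
    ∀ (W : WeierstrassCurve ℚ) [W.IsElliptic] [W.IsGloballyMinimal] (p : ℕ) [Fact p.Prime],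
    ∀ (N : ℕ) [NeZero N] (K : Type) [Field K] [NumberField K] (Dt : ModularParametrizationData W N)
      (H : HeegnerDatum N (NumberField.discr K)) (ιK : K →+* ℂ) (P : (W.baseChange K).toAffine.Point),
      CellC W p → W.conductorNorm ℤ = N →
      IsImaginaryQuadratic K → NumberField.discr K < -4 → SatisfiesHeegnerHypothesis N K →
      (W.quadraticTwist (NumberField.discr K : ℚ)).entireLFunction 1 ≠ 0 →
      WeierstrassCurve.Affine.Point.map ιK.toRatAlgHom P = heegnerPointComplex Dt H →
      ¬ (p : ℤ) ∣ Dt.c → ¬ IsOfFinAddOrder P →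
      Odd (NumberField.discr K) →
      ∀ (κ : ZpExtension K p), κ.IsAnticyclotomic →
        ∀ (γ : Field.absoluteGaloisGroup K) [Fact (κ.IsTopGenerator γ)]
          (𝔭 : HeightOneSpectrum (𝓞 K)), ((p : ℕ) : 𝓞 K) ∈ 𝔭.asIdeal →
          𝔭.asIdeal.ramificationIdx (𝓞 ℚ) = 1 → 𝔭.asIdeal.inertiaDeg (𝓞 ℚ) = 1 →
          ∀ (𝔭bar : HeightOneSpectrum (𝓞 K)), ((p : ℕ) : 𝓞 K) ∈ 𝔭bar.asIdeal → 𝔭bar ≠ 𝔭 →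
            ((Ideal.span {(p : ℤ)}).primesOver (𝓞 K)).ncard = 2 →
          ∀ (f : CuspForm (CongruenceSubgroup.Gamma0 N) 2), IsNewformOf W f →
            ∀ (ι' : PadicAlgCl p ≃+* ℂ),
              (∀ (w : InfinitePlace K) (k : 𝓞 K),
                k ∈ 𝔭.asIdeal ↔ ‖ι'.symm (w.embedding (k : K))‖ < 1) →
              ∀ (ΩK : ℂ) (Ωp : ℂ_[p]) (Q : PowerSeries 𝓞_ℂ_[p]), ΩK ≠ 0 → ‖Ωp‖ = 1 →
                R1.IsBDPLFunctionInt p ι' 𝔭 κ γ f ΩK Ωp Q →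
      ∀ (L : PowerSeries (PowerSeries (unrIntegers p))) (x : ℕ → ℤ_[p]) (D : ℕ → Skinner2016.HidaCongruentForm W p 1),
        (∀ k, ‖x k‖ < 1) ∧ Filter.Tendsto x Filter.atTop (nhds 0) ∧
        (∃ e : ℕ, PowerSeries.C ((p : 𝓞_ℂ_[p]) ^ e) * Q ∈
          Ideal.span {PowerSeries.map (R1.unrToCpInt p) (PowerSeries.map (PowerSeries.constantCoeff (R := unrIntegers p)) L)}) ∧
        (∀ k : ℕ, (∀ y : coeffField (D k).g, ι' ((D k).ι y) = (y : ℂ)) ∧ 2 * ((p : ℤ) - 1) ∣ (D k).k - 2 ∧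
          ∃ (ΩKg : ℂ) (Ωpg : ℂ_[p]) (Lg : UnrSeries p), ΩKg ≠ 0 ∧ ‖Ωpg‖ = 1 ∧
            IsBDPLFunctionWt ι' 𝔭 κ γ (D k).g ΩKg Ωpg Lg ∧
          ∃ Ψ : UnrSeries p,
            (∃ U : PowerSeries (PowerSeries (unrIntegers p)),
              PowerSeries.map (PowerSeries.C (R := unrIntegers p)) Ψ =
                L + PowerSeries.C (PowerSeries.X - PowerSeries.C (toUnr p (x k))) * U) ∧
            (∃ e : ℕ, PowerSeries.C ((p : 𝓞_ℂ_[p]) ^ e) * PowerSeries.map (R1.unrToCpInt p) Ψ ∈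
              Ideal.span {PowerSeries.map (R1.unrToCpInt p) Lg})) ∧
        (∃ A : ℕ → UnrSeries p, ∀ ℓ : ℕ, ℓ.Prime → ¬ ℓ ∣ N →
          (∃ U : UnrSeries p, A ℓ = PowerSeries.C (toUnr p ((W.frobeniusTrace ℓ : ℤ) : ℤ_[p])) + PowerSeries.X * U) ∧
          ∀ k : ℕ, ∃ (c : unrIntegers p) (U : UnrSeries p),
            A ℓ = PowerSeries.C c + (PowerSeries.X - PowerSeries.C (toUnr p (x k))) * U ∧
            ((c : ℂ_[p]) = algebraMap (PadicAlgCl p) ℂ_[p]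
              ((D k).ι ⟨(UpperHalfPlane.qExpansion 1 ⇑(D k).g).coeff ℓ, coeff_mem_coeffField (D k).g ℓ⟩))) →
      ∀ [TopologicalSpace (PowerSeries ℤ_[p])] (A₂ : Type) [AddCommGroup A₂]
        [Module (PowerSeries ℤ_[p]) A₂] [TopologicalSpace A₂] [DiscreteTopology A₂]
        (ρ₂ : ContinuousRep (Field.absoluteGaloisGroup K) (PowerSeries ℤ_[p]) A₂)
        [TopologicalSpace (PowerSeries (PowerSeries ℤ_[p]))]
        [ContinuousSMul (PowerSeries (PowerSeries ℤ_[p])) (BigRepModule (PowerSeries ℤ_[p]) p A₂)]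
        [Module (PowerSeries ℤ_[p]) (XBig κ ρ₂ 𝔭bar (∅ : Set (HeightOneSpectrum (𝓞 K))))]
        [IsScalarTower (PowerSeries ℤ_[p]) (PowerSeries (PowerSeries ℤ_[p]))
          (XBig κ ρ₂ 𝔭bar (∅ : Set (HeightOneSpectrum (𝓞 K))))],
        ((∀ a : A₂, ∃ n : ℕ, (PowerSeries.X : PowerSeries ℤ_[p]) ^ n • a = 0) ∧
          (∀ a : A₂, ∃ b : A₂, (PowerSeries.X : PowerSeries ℤ_[p]) • b = a) ∧
          (∀ (k : ℕ) (a : A₂), ∃ b : A₂, (PowerSeries.X - PowerSeries.C (x k)) • b = a) ∧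
          (∃ S₀ : Set (HeightOneSpectrum (𝓞 K)), S₀.Finite ∧ GaloisRep.IsUnramifiedOutside S₀ ρ₂) ∧
          (∃ θ₀ : Submodule.torsionBy (PowerSeries ℤ_[p]) A₂ (PowerSeries.X : PowerSeries ℤ_[p]) →+
              PrimaryTorsion (W.baseChange K).geomPoints p,
            (∀ (c : ℤ_[p]) (a : Submodule.torsionBy (PowerSeries ℤ_[p]) A₂ (PowerSeries.X : PowerSeries ℤ_[p])),
                θ₀ (PowerSeries.C c • a) = c • θ₀ a) ∧
            (∀ (σ : Field.absoluteGaloisGroup K)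
                (a : Submodule.torsionBy (PowerSeries ℤ_[p]) A₂ (PowerSeries.X : PowerSeries ℤ_[p])),
                θ₀ (BigGaloisRep.torsionRep ρ₂ (PowerSeries.X : PowerSeries ℤ_[p]) σ a) =
                  (W.baseChange K).primaryTorsionGaloisRep p σ (θ₀ a)) ∧
            Finite θ₀.ker ∧ Finite (PrimaryTorsion (W.baseChange K).geomPoints p ⧸ θ₀.range)) ∧
          (∀ k : ℕ, Function.Surjective (algebraMap ℤ_[p] (padicCoeffIntegers (D k).ι)) ∧
            ∃ θ : Submodule.torsionBy (PowerSeries ℤ_[p]) A₂ (PowerSeries.X - PowerSeries.C (x k)) →+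
                Cofree (D k).Δ.selfDualRep (padicCoeffField (D k).ι),
              (∀ (c : ℤ_[p])
                  (a : Submodule.torsionBy (PowerSeries ℤ_[p]) A₂ (PowerSeries.X - PowerSeries.C (x k))),
                  θ (PowerSeries.C c • a) = algebraMap ℤ_[p] (padicCoeffIntegers (D k).ι) c • θ a) ∧
              (∀ (σ : Field.absoluteGaloisGroup K)
                  (a : Submodule.torsionBy (PowerSeries ℤ_[p]) A₂ (PowerSeries.X - PowerSeries.C (x k))),
                  θ (BigGaloisRep.torsionRep ρ₂ (PowerSeries.X - PowerSeries.C (x k)) σ a) =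
                    (D k).Δ.selfDualCofreeRepOver K σ (θ a)) ∧
              Finite θ.ker ∧ Finite (Cofree (D k).Δ.selfDualRep (padicCoeffField (D k).ι) ⧸ θ.range))) →
        ∀ [Module (PowerSeries ℤ_[p]) (CharacterModule (TorsionControl.selmer (localMap K) (strictSet p 𝔭bar (∅ : Set (HeightOneSpectrum (𝓞 K))))
            (TorsionControl.torsionRep (AnticyclotomicBigGaloisRep κ ρ₂) (PowerSeries.C (PowerSeries.X : PowerSeries ℤ_[p])))))]
          [IsScalarTower (PowerSeries ℤ_[p]) (PowerSeries (PowerSeries ℤ_[p]))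
            (CharacterModule (TorsionControl.selmer (localMap K) (strictSet p 𝔭bar (∅ : Set (HeightOneSpectrum (𝓞 K))))
            (TorsionControl.torsionRep (AnticyclotomicBigGaloisRep κ ρ₂) (PowerSeries.C (PowerSeries.X : PowerSeries ℤ_[p])))))],
          Module.Finite (PowerSeries ℤ_[p]) (CharacterModule (TorsionControl.selmer (localMap K) (strictSet p 𝔭bar (∅ : Set (HeightOneSpectrum (𝓞 K))))
            (TorsionControl.torsionRep (AnticyclotomicBigGaloisRep κ ρ₂) (PowerSeries.C (PowerSeries.X : PowerSeries ℤ_[p]))))) ∧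
          Module.IsTorsion (PowerSeries ℤ_[p]) (CharacterModule (TorsionControl.selmer (localMap K) (strictSet p 𝔭bar (∅ : Set (HeightOneSpectrum (𝓞 K))))
            (TorsionControl.torsionRep (AnticyclotomicBigGaloisRep κ ρ₂) (PowerSeries.C (PowerSeries.X : PowerSeries ℤ_[p]))))) ∧
          (∃ e : ℕ, Ideal.span {PowerSeries.C ((p : ℤ_[p]) ^ e)} *
              Literature.NumberTheory.EllipticCurves.Module.charIdeal (PowerSeries ℤ_[p])
                (CharacterModule (TorsionControl.selmer (localMap K) (strictSet p 𝔭bar (∅ : Set (HeightOneSpectrum (𝓞 K))))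
            (TorsionControl.torsionRep (AnticyclotomicBigGaloisRep κ ρ₂) (PowerSeries.C (PowerSeries.X : PowerSeries ℤ_[p]))))) ≤
            XAc.charIdeal (W.baseChange K) p κ 𝔭bar ∅ γ) :=
  TelescopeK2WeightTwoFg.weightTwoTransport_of_E hE

/-! ## §W4 (pure) — purity of the `(C X)`-torsion (research S/M; = K2-M clause (pure) token for token) -/

set_option maxHeartbeats 800000 in
/-- **stub_weightTwoPurity** (W4) [CONTENT — research S/M; the clause (pure) of K2-M (`K2Mod.stub_branchFibreControl`, `Lines/telescopeK2module.lean`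
v1.1 l.306–311) TOKEN FOR TOKEN]. For every `ρ₂` with FD: `(p^m) ⊆ char_Λ(X₂[C X])` for some `m` — the `(C X)`-torsion of `X₂` is `Λ`-pseudo-`p`-power.
Proof plan: ideator g33's `Lines/telescopeK2purity.lean` (`K2Pur.module_of_sat`, sorry-free there): (pure) ⟸ (sat) «`p^b·Sel(M₂) ∩ X·H¹ ⊆ X·Sel(M₂)`-type
saturation» + (div) «`H¹(Γ_K, M₂)` is `X`-divisible up to `p`-power» read through `torsionBy_XBig_eq_bot` / `smul_eq_zero_of_mem_torsionBy_XBig`;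
classically: `X₂` has no non-zero pseudo-null `B`-submodule prime to `p` (Greenberg 2016 Prop. 4.1.1 when SUR + `(T₂*/𝔪T₂*)^{G_K} = 0`; Ochiai 2006
Prop. 8.1, Compositio 142 p. 1192: `(Sel_T)^∨` has no non-trivial pseudo-null submodule when the lattice is FREE of rank two (Fr), the coefficient
ring is a regular local ring, and `Σ = {p, ∞}` — no irreducibility assumed; on Cell C the residual representation is reducible, `B = ℤ_p⟦X⟧⟦T⟧` is
regular, (Fr) holds for the reflexive branch lattice, but `Σ ⊋ {p, ∞}` (conductor `N`), and the bet — card F8/F9 — is that the only pseudo-null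
`(C X)`-torsion is Herbrand-matched or `p`-power).
Why it might fail: a pseudo-null `B/(C X, g(T)) ⊂ X₂` with `g ∉ p^ℕ·Λ^×` not matched in `X₂/(C X)X₂` — e.g. from a trivial-zero phenomenon of the
BRANCH (not of `E`) at weight two; then (div₀) must be proved directly (K2-M♭ was introduced for exactly this contingency, card F8).
Sources: [cite: Ochiai2006, Prop. 8.1 and Lemma 8.4 (p. 1192–1193)] [cite: Greenberg2016, Prop. 4.1.1] [cite: SkinnerUrban2014, Cor. 3.2.9]
[cite: BourbakiAC5to7, VII §4.4–4.5] -/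
theorem stub_weightTwoPurity :
    ∀ (W : WeierstrassCurve ℚ) [W.IsElliptic] [W.IsGloballyMinimal] (p : ℕ) [Fact p.Prime],
    ∀ (N : ℕ) [NeZero N] (K : Type) [Field K] [NumberField K] (Dt : ModularParametrizationData W N)
      (H : HeegnerDatum N (NumberField.discr K)) (ιK : K →+* ℂ) (P : (W.baseChange K).toAffine.Point),
      CellC W p → W.conductorNorm ℤ = N →
      IsImaginaryQuadratic K → NumberField.discr K < -4 → SatisfiesHeegnerHypothesis N K →
      (W.quadraticTwist (NumberField.discr K : ℚ)).entireLFunction 1 ≠ 0 →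
      WeierstrassCurve.Affine.Point.map ιK.toRatAlgHom P = heegnerPointComplex Dt H →
      ¬ (p : ℤ) ∣ Dt.c → ¬ IsOfFinAddOrder P →
      Odd (NumberField.discr K) →
      ∀ (κ : ZpExtension K p), κ.IsAnticyclotomic →
        ∀ (γ : Field.absoluteGaloisGroup K) [Fact (κ.IsTopGenerator γ)]
          (𝔭 : HeightOneSpectrum (𝓞 K)), ((p : ℕ) : 𝓞 K) ∈ 𝔭.asIdeal →
          𝔭.asIdeal.ramificationIdx (𝓞 ℚ) = 1 → 𝔭.asIdeal.inertiaDeg (𝓞 ℚ) = 1 →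
          ∀ (𝔭bar : HeightOneSpectrum (𝓞 K)), ((p : ℕ) : 𝓞 K) ∈ 𝔭bar.asIdeal → 𝔭bar ≠ 𝔭 →
            ((Ideal.span {(p : ℤ)}).primesOver (𝓞 K)).ncard = 2 →
          ∀ (f : CuspForm (CongruenceSubgroup.Gamma0 N) 2), IsNewformOf W f →
            ∀ (ι' : PadicAlgCl p ≃+* ℂ),
              (∀ (w : InfinitePlace K) (k : 𝓞 K),
                k ∈ 𝔭.asIdeal ↔ ‖ι'.symm (w.embedding (k : K))‖ < 1) →
              ∀ (ΩK : ℂ) (Ωp : ℂ_[p]) (Q : PowerSeries 𝓞_ℂ_[p]), ΩK ≠ 0 → ‖Ωp‖ = 1 →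
                R1.IsBDPLFunctionInt p ι' 𝔭 κ γ f ΩK Ωp Q →
      ∀ (L : PowerSeries (PowerSeries (unrIntegers p))) (x : ℕ → ℤ_[p]) (D : ℕ → Skinner2016.HidaCongruentForm W p 1),
        (∀ k, ‖x k‖ < 1) ∧ Filter.Tendsto x Filter.atTop (nhds 0) ∧
        (∃ e : ℕ, PowerSeries.C ((p : 𝓞_ℂ_[p]) ^ e) * Q ∈
          Ideal.span {PowerSeries.map (R1.unrToCpInt p) (PowerSeries.map (PowerSeries.constantCoeff (R := unrIntegers p)) L)}) ∧
        (∀ k : ℕ, (∀ y : coeffField (D k).g, ι' ((D k).ι y) = (y : ℂ)) ∧ 2 * ((p : ℤ) - 1) ∣ (D k).k - 2 ∧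
          ∃ (ΩKg : ℂ) (Ωpg : ℂ_[p]) (Lg : UnrSeries p), ΩKg ≠ 0 ∧ ‖Ωpg‖ = 1 ∧
            IsBDPLFunctionWt ι' 𝔭 κ γ (D k).g ΩKg Ωpg Lg ∧
          ∃ Ψ : UnrSeries p,
            (∃ U : PowerSeries (PowerSeries (unrIntegers p)),
              PowerSeries.map (PowerSeries.C (R := unrIntegers p)) Ψ =
                L + PowerSeries.C (PowerSeries.X - PowerSeries.C (toUnr p (x k))) * U) ∧
            (∃ e : ℕ, PowerSeries.C ((p : 𝓞_ℂ_[p]) ^ e) * PowerSeries.map (R1.unrToCpInt p) Ψ ∈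
              Ideal.span {PowerSeries.map (R1.unrToCpInt p) Lg})) ∧
        (∃ A : ℕ → UnrSeries p, ∀ ℓ : ℕ, ℓ.Prime → ¬ ℓ ∣ N →
          (∃ U : UnrSeries p, A ℓ = PowerSeries.C (toUnr p ((W.frobeniusTrace ℓ : ℤ) : ℤ_[p])) + PowerSeries.X * U) ∧
          ∀ k : ℕ, ∃ (c : unrIntegers p) (U : UnrSeries p),
            A ℓ = PowerSeries.C c + (PowerSeries.X - PowerSeries.C (toUnr p (x k))) * U ∧
            ((c : ℂ_[p]) = algebraMap (PadicAlgCl p) ℂ_[p]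
              ((D k).ι ⟨(UpperHalfPlane.qExpansion 1 ⇑(D k).g).coeff ℓ, coeff_mem_coeffField (D k).g ℓ⟩))) →
      ∀ [TopologicalSpace (PowerSeries ℤ_[p])] (A₂ : Type) [AddCommGroup A₂]
        [Module (PowerSeries ℤ_[p]) A₂] [TopologicalSpace A₂] [DiscreteTopology A₂]
        (ρ₂ : ContinuousRep (Field.absoluteGaloisGroup K) (PowerSeries ℤ_[p]) A₂)
        [TopologicalSpace (PowerSeries (PowerSeries ℤ_[p]))]
        [ContinuousSMul (PowerSeries (PowerSeries ℤ_[p])) (BigRepModule (PowerSeries ℤ_[p]) p A₂)]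
        [Module (PowerSeries ℤ_[p]) (XBig κ ρ₂ 𝔭bar (∅ : Set (HeightOneSpectrum (𝓞 K))))]
        [IsScalarTower (PowerSeries ℤ_[p]) (PowerSeries (PowerSeries ℤ_[p]))
          (XBig κ ρ₂ 𝔭bar (∅ : Set (HeightOneSpectrum (𝓞 K))))],
        ((∀ a : A₂, ∃ n : ℕ, (PowerSeries.X : PowerSeries ℤ_[p]) ^ n • a = 0) ∧
          (∀ a : A₂, ∃ b : A₂, (PowerSeries.X : PowerSeries ℤ_[p]) • b = a) ∧
          (∀ (k : ℕ) (a : A₂), ∃ b : A₂, (PowerSeries.X - PowerSeries.C (x k)) • b = a) ∧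
          (∃ S₀ : Set (HeightOneSpectrum (𝓞 K)), S₀.Finite ∧ GaloisRep.IsUnramifiedOutside S₀ ρ₂) ∧
          (∃ θ₀ : Submodule.torsionBy (PowerSeries ℤ_[p]) A₂ (PowerSeries.X : PowerSeries ℤ_[p]) →+
              PrimaryTorsion (W.baseChange K).geomPoints p,
            (∀ (c : ℤ_[p]) (a : Submodule.torsionBy (PowerSeries ℤ_[p]) A₂ (PowerSeries.X : PowerSeries ℤ_[p])),
                θ₀ (PowerSeries.C c • a) = c • θ₀ a) ∧
            (∀ (σ : Field.absoluteGaloisGroup K)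
                (a : Submodule.torsionBy (PowerSeries ℤ_[p]) A₂ (PowerSeries.X : PowerSeries ℤ_[p])),
                θ₀ (BigGaloisRep.torsionRep ρ₂ (PowerSeries.X : PowerSeries ℤ_[p]) σ a) =
                  (W.baseChange K).primaryTorsionGaloisRep p σ (θ₀ a)) ∧
            Finite θ₀.ker ∧ Finite (PrimaryTorsion (W.baseChange K).geomPoints p ⧸ θ₀.range)) ∧
          (∀ k : ℕ, Function.Surjective (algebraMap ℤ_[p] (padicCoeffIntegers (D k).ι)) ∧
            ∃ θ : Submodule.torsionBy (PowerSeries ℤ_[p]) A₂ (PowerSeries.X - PowerSeries.C (x k)) →+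
                Cofree (D k).Δ.selfDualRep (padicCoeffField (D k).ι),
              (∀ (c : ℤ_[p])
                  (a : Submodule.torsionBy (PowerSeries ℤ_[p]) A₂ (PowerSeries.X - PowerSeries.C (x k))),
                  θ (PowerSeries.C c • a) = algebraMap ℤ_[p] (padicCoeffIntegers (D k).ι) c • θ a) ∧
              (∀ (σ : Field.absoluteGaloisGroup K)
                  (a : Submodule.torsionBy (PowerSeries ℤ_[p]) A₂ (PowerSeries.X - PowerSeries.C (x k))),
                  θ (BigGaloisRep.torsionRep ρ₂ (PowerSeries.X - PowerSeries.C (x k)) σ a) =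
                    (D k).Δ.selfDualCofreeRepOver K σ (θ a)) ∧
              Finite θ.ker ∧ Finite (Cofree (D k).Δ.selfDualRep (padicCoeffField (D k).ι) ⧸ θ.range))) →
        ∃ m : ℕ, Ideal.span {PowerSeries.C ((p : ℤ_[p]) ^ m)} ≤
          Literature.NumberTheory.EllipticCurves.Module.charIdeal (PowerSeries ℤ_[p])
            (Submodule.torsionBy (PowerSeries (PowerSeries ℤ_[p]))
              (XBig κ ρ₂ 𝔭bar (∅ : Set (HeightOneSpectrum (𝓞 K))))
              (PowerSeries.C (PowerSeries.X : PowerSeries ℤ_[p]))) := by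
  sorry

/-! ## §W4⁰ (route G, `p`-tolerant) — every pseudo-null submodule of the big dual Selmer module is `p`-power torsion (v1.2) -/

set_option maxHeartbeats 800000 in
/-- **stub_bigPseudoNullPTorsion** (W4⁰) [CONTENT — route G′ (`p`-tolerant route G), bench L; NEW in v1.2]. For every `ρ₂` with FD, UNDER (fg) and
(reg₀) (both supplied by the kernel from W1–W3): every pseudo-null `B`-submodule `P` of `X₂ = XBig κ ρ₂ 𝔭̄ ∅` (`B = ℤ_p⟦X⟧⟦T⟧`) is killed by `p^m` for some
`m` — the `p`-TOLERANT form of «`X₂` has no non-zero pseudo-null submodule» = «`Sel_{𝔭̄,∅}(K, M₂)` is almost `B`-divisible» (Greenberg 2016 §1 p. 2).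
The STRICT form can fail: at `w ∣ N` the unramified condition `L_w = H¹_ur(K_w, M₂)` need not be almost divisible (memo §W4-G (G5-w)), and then
`X₂ ⊇ (S_𝓛/S_{𝓛_div})^∨`, pseudo-null and in general non-zero. PLAN (memo `W-PRICING-n2.md` rev 1.7 §W4-G′, priced binder by binder): (1) `𝓛_div` := the almost-divisible
core of `𝓛 = specOfIndexSet Σ ρ (strictSet p 𝔭̄ ∅)` (`L_{v,div}^∨ = L_v^∨ / Z_v`, `Z_v` the maximal pseudo-null submodule; at `𝔭`: `L_𝔭 = H¹(K_𝔭, M₂)` is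
already almost divisible by `Greenberg2016.prop422_localCohomology_isAlmostDivisible_holds` ⇐ RFX + `H²(K_𝔭, M₂) = 0`; at `𝔭̄`, `∞`: `0`); (2) the kernel
`(S_𝓛/S_{𝓛_div})^∨` of `X₂ = X_𝓛 ↠ X_{𝓛_div}` is a quotient of `⊕_{w ∣ N} Z_w`, and `Z_w ≤ maxPN((A₂^{I_w})^∨ ⊗̂_{ℤ_p⟦X⟧} B) = F_w⟦T⟧` (`I_w` acts
trivially on `Λ(Ψ)`; associated primes under the FLAT base change `ℤ_p⟦X⟧ → B` are extended primes of the same height, so the maximal pseudo-null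
submodule of `V⟦T⟧` is `F⟦T⟧`, `F` = the finite part of `V`) is killed by `p^{a_w}` — AUTOMATIC, no local hypothesis at `w ∣ N`; (3) Greenberg 2016
Prop. 4.1.1 (c) for `𝓛_div` at `η = 𝔭`, `Λ = R = B`, in the `h_K`-free totally-complex reading
`Greenberg2016.selmer_noPseudoNull_caseC_of_prop321_of_isCotorsion_H_two'` (no [Gr4] fact, no LOC⁽²⁾; `h321` assembled in the tree:
`SurLambda.sur_of_crk_caseC_tc_of_dualSha_torsion` ∘ `Greenberg2016.dualSha_torsion_of_poitouTateAt`, Poitou–Tate = PUB conjunct), with `ρ` descended to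
`G_{K,Σ}` (`TelescopeK2RepDescent.descendUnramified`, p746306) and `S_𝓛 ≃ₗ[B] Sel_{𝔭̄,∅}` (`TelescopeK2SelmerDictionary.selmerEquivOfKer`, p747353): its
hypotheses are `IsCofree B M₂` + RFX (⇐ N1's FREE branch lattice), `p`-primarity, CRK + `IsCotorsion B H²(G_{K,Σ}, M₂)` (⇐ (reg₀) + (fg): `corank_B S_𝓛 = 0`,
Tate's global Euler characteristic at totally complex `K` gives `corank H¹(G_Σ, M₂) = 2 + corank H²`, the local coranks sum to `2`, squeeze), LOC⁽¹⁾ at `𝔭`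
(`Ψ|G_{K_𝔭}` infinitely ramified), `Q_{𝓛_div}(K_𝔭) = 0`; ⇒ `X_{𝓛_div}` has no non-zero pseudo-null submodule; (4) the extension principle
`TelescopeK2PurityOfPTorsionPseudoNull.forall_isPseudoNull_pow_smul_eq_zero_of_quotient` (p754825) ⇒ W4⁰.
Why it might fail: a pseudo-null `B/(C X, g(T)) ⊂ X₂` with `g ∉ p^ℕ·Λ^×` contradicts (3) unless RFX fails — a NON-REFLEXIVE branch lattice `𝕋₂` at the
Eisenstein prime `p` (Cell C is residually reducible; lattice choice matters): the reflexive hull changes `X₂` by a map whose KERNEL must be shown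
`p`-power torsion (then tolerance absorbs it) — unverified. Degenerate-witness audit: under (reg₀) `X₂` is `B`-torsion; `X₂ = 0` gives `m = 0` (no content
claimed); FD's (fd₀) excludes `A₂ = 0`; the hypotheses (fg), (reg₀) are theorems of the kernel, not vacuous.
Sources: [cite: Greenberg2016Selmer, §1 p. 2, Prop. 4.1.1 (c) (§4.1 p. 15 L21–32), Prop. 4.2.2 (§4.2 p. 20 L4–8)] [cite: Greenberg2010, Prop. 3.2.1 (c)]
[cite: Ochiai2006, Prop. 8.1 and Lemma 8.4 (p. 1192–1193)] [cite: BourbakiAC5to7, IV §2.6 Thm. 2, VII §4.4–4.5] [cite: MilneADT2006, I Thm. 4.10 (a), I Thm. 5.1] -/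
theorem stub_bigPseudoNullPTorsion :
    ∀ (W : WeierstrassCurve ℚ) [W.IsElliptic] [W.IsGloballyMinimal] (p : ℕ) [Fact p.Prime],
    ∀ (N : ℕ) [NeZero N] (K : Type) [Field K] [NumberField K] (Dt : ModularParametrizationData W N)
      (H : HeegnerDatum N (NumberField.discr K)) (ιK : K →+* ℂ) (P : (W.baseChange K).toAffine.Point),
      CellC W p → W.conductorNorm ℤ = N →
      IsImaginaryQuadratic K → NumberField.discr K < -4 → SatisfiesHeegnerHypothesis N K →
      (W.quadraticTwist (NumberField.discr K : ℚ)).entireLFunction 1 ≠ 0 →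
      WeierstrassCurve.Affine.Point.map ιK.toRatAlgHom P = heegnerPointComplex Dt H →
      ¬ (p : ℤ) ∣ Dt.c → ¬ IsOfFinAddOrder P →
      Odd (NumberField.discr K) →
      ∀ (κ : ZpExtension K p), κ.IsAnticyclotomic →
        ∀ (γ : Field.absoluteGaloisGroup K) [Fact (κ.IsTopGenerator γ)]
          (𝔭 : HeightOneSpectrum (𝓞 K)), ((p : ℕ) : 𝓞 K) ∈ 𝔭.asIdeal →
          𝔭.asIdeal.ramificationIdx (𝓞 ℚ) = 1 → 𝔭.asIdeal.inertiaDeg (𝓞 ℚ) = 1 →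
          ∀ (𝔭bar : HeightOneSpectrum (𝓞 K)), ((p : ℕ) : 𝓞 K) ∈ 𝔭bar.asIdeal → 𝔭bar ≠ 𝔭 →
            ((Ideal.span {(p : ℤ)}).primesOver (𝓞 K)).ncard = 2 →
          ∀ (f : CuspForm (CongruenceSubgroup.Gamma0 N) 2), IsNewformOf W f →
            ∀ (ι' : PadicAlgCl p ≃+* ℂ),
              (∀ (w : InfinitePlace K) (k : 𝓞 K),
                k ∈ 𝔭.asIdeal ↔ ‖ι'.symm (w.embedding (k : K))‖ < 1) →
              ∀ (ΩK : ℂ) (Ωp : ℂ_[p]) (Q : PowerSeries 𝓞_ℂ_[p]), ΩK ≠ 0 → ‖Ωp‖ = 1 →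
                R1.IsBDPLFunctionInt p ι' 𝔭 κ γ f ΩK Ωp Q →
      ∀ (L : PowerSeries (PowerSeries (unrIntegers p))) (x : ℕ → ℤ_[p]) (D : ℕ → Skinner2016.HidaCongruentForm W p 1),
        (∀ k, ‖x k‖ < 1) ∧ Filter.Tendsto x Filter.atTop (nhds 0) ∧
        (∃ e : ℕ, PowerSeries.C ((p : 𝓞_ℂ_[p]) ^ e) * Q ∈
          Ideal.span {PowerSeries.map (R1.unrToCpInt p) (PowerSeries.map (PowerSeries.constantCoeff (R := unrIntegers p)) L)}) ∧
        (∀ k : ℕ, (∀ y : coeffField (D k).g, ι' ((D k).ι y) = (y : ℂ)) ∧ 2 * ((p : ℤ) - 1) ∣ (D k).k - 2 ∧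
          ∃ (ΩKg : ℂ) (Ωpg : ℂ_[p]) (Lg : UnrSeries p), ΩKg ≠ 0 ∧ ‖Ωpg‖ = 1 ∧
            IsBDPLFunctionWt ι' 𝔭 κ γ (D k).g ΩKg Ωpg Lg ∧
          ∃ Ψ : UnrSeries p,
            (∃ U : PowerSeries (PowerSeries (unrIntegers p)),
              PowerSeries.map (PowerSeries.C (R := unrIntegers p)) Ψ =
                L + PowerSeries.C (PowerSeries.X - PowerSeries.C (toUnr p (x k))) * U) ∧
            (∃ e : ℕ, PowerSeries.C ((p : 𝓞_ℂ_[p]) ^ e) * PowerSeries.map (R1.unrToCpInt p) Ψ ∈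
              Ideal.span {PowerSeries.map (R1.unrToCpInt p) Lg})) ∧
        (∃ A : ℕ → UnrSeries p, ∀ ℓ : ℕ, ℓ.Prime → ¬ ℓ ∣ N →
          (∃ U : UnrSeries p, A ℓ = PowerSeries.C (toUnr p ((W.frobeniusTrace ℓ : ℤ) : ℤ_[p])) + PowerSeries.X * U) ∧
          ∀ k : ℕ, ∃ (c : unrIntegers p) (U : UnrSeries p),
            A ℓ = PowerSeries.C c + (PowerSeries.X - PowerSeries.C (toUnr p (x k))) * U ∧
            ((c : ℂ_[p]) = algebraMap (PadicAlgCl p) ℂ_[p]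
              ((D k).ι ⟨(UpperHalfPlane.qExpansion 1 ⇑(D k).g).coeff ℓ, coeff_mem_coeffField (D k).g ℓ⟩))) →
      ∀ [TopologicalSpace (PowerSeries ℤ_[p])] (A₂ : Type) [AddCommGroup A₂]
        [Module (PowerSeries ℤ_[p]) A₂] [TopologicalSpace A₂] [DiscreteTopology A₂]
        (ρ₂ : ContinuousRep (Field.absoluteGaloisGroup K) (PowerSeries ℤ_[p]) A₂)
        [TopologicalSpace (PowerSeries (PowerSeries ℤ_[p]))]
        [ContinuousSMul (PowerSeries (PowerSeries ℤ_[p])) (BigRepModule (PowerSeries ℤ_[p]) p A₂)],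
        ((∀ a : A₂, ∃ n : ℕ, (PowerSeries.X : PowerSeries ℤ_[p]) ^ n • a = 0) ∧
          (∀ a : A₂, ∃ b : A₂, (PowerSeries.X : PowerSeries ℤ_[p]) • b = a) ∧
          (∀ (k : ℕ) (a : A₂), ∃ b : A₂, (PowerSeries.X - PowerSeries.C (x k)) • b = a) ∧
          (∃ S₀ : Set (HeightOneSpectrum (𝓞 K)), S₀.Finite ∧ GaloisRep.IsUnramifiedOutside S₀ ρ₂) ∧
          (∃ θ₀ : Submodule.torsionBy (PowerSeries ℤ_[p]) A₂ (PowerSeries.X : PowerSeries ℤ_[p]) →+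
              PrimaryTorsion (W.baseChange K).geomPoints p,
            (∀ (c : ℤ_[p]) (a : Submodule.torsionBy (PowerSeries ℤ_[p]) A₂ (PowerSeries.X : PowerSeries ℤ_[p])),
                θ₀ (PowerSeries.C c • a) = c • θ₀ a) ∧
            (∀ (σ : Field.absoluteGaloisGroup K)
                (a : Submodule.torsionBy (PowerSeries ℤ_[p]) A₂ (PowerSeries.X : PowerSeries ℤ_[p])),
                θ₀ (BigGaloisRep.torsionRep ρ₂ (PowerSeries.X : PowerSeries ℤ_[p]) σ a) =
                  (W.baseChange K).primaryTorsionGaloisRep p σ (θ₀ a)) ∧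
            Finite θ₀.ker ∧ Finite (PrimaryTorsion (W.baseChange K).geomPoints p ⧸ θ₀.range)) ∧
          (∀ k : ℕ, Function.Surjective (algebraMap ℤ_[p] (padicCoeffIntegers (D k).ι)) ∧
            ∃ θ : Submodule.torsionBy (PowerSeries ℤ_[p]) A₂ (PowerSeries.X - PowerSeries.C (x k)) →+
                Cofree (D k).Δ.selfDualRep (padicCoeffField (D k).ι),
              (∀ (c : ℤ_[p])
                  (a : Submodule.torsionBy (PowerSeries ℤ_[p]) A₂ (PowerSeries.X - PowerSeries.C (x k))),
                  θ (PowerSeries.C c • a) = algebraMap ℤ_[p] (padicCoeffIntegers (D k).ι) c • θ a) ∧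
              (∀ (σ : Field.absoluteGaloisGroup K)
                  (a : Submodule.torsionBy (PowerSeries ℤ_[p]) A₂ (PowerSeries.X - PowerSeries.C (x k))),
                  θ (BigGaloisRep.torsionRep ρ₂ (PowerSeries.X - PowerSeries.C (x k)) σ a) =
                    (D k).Δ.selfDualCofreeRepOver K σ (θ a)) ∧
              Finite θ.ker ∧ Finite (Cofree (D k).Δ.selfDualRep (padicCoeffField (D k).ι) ⧸ θ.range))) →
        Module.Finite (PowerSeries (PowerSeries ℤ_[p])) (XBig κ ρ₂ 𝔭bar (∅ : Set (HeightOneSpectrum (𝓞 K)))) →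
        (∃ s : PowerSeries (PowerSeries ℤ_[p]),
          ¬ (PowerSeries.C (PowerSeries.X : PowerSeries ℤ_[p]) ∣ s) ∧
            ∀ m : XBig κ ρ₂ 𝔭bar (∅ : Set (HeightOneSpectrum (𝓞 K))), s • m = 0) →
        ∀ P : Submodule (PowerSeries (PowerSeries ℤ_[p])) (XBig κ ρ₂ 𝔭bar (∅ : Set (HeightOneSpectrum (𝓞 K)))),
          Literature.NumberTheory.EllipticCurves.Module.IsPseudoNull (PowerSeries (PowerSeries ℤ_[p])) ↥P →
            ∃ m : ℕ, ∀ x ∈ P, (p : PowerSeries (PowerSeries ℤ_[p])) ^ m • x = 0 := by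
  sorry

/-! ## §P (v1.2, sorry-free) W4 ⟸ W2 ∧ W3 ∧ W4⁰ — purity from the `p`-tolerant route-G input -/

set_option maxHeartbeats 1600000 in
/-- **W4 from W4⁰** (`p`-tolerant no-pseudo-null) **+ W2 + W3** (SORRY-FREE; W1 by name): (reg₀) as in the kernel `weightTwoControl_of_subleaves`
(W2's kernel clause + W3's `Λ`-torsion of `Y`, `s ≡ φ₀ s (mod C X)`, then x2-p2 g18's determinant trick
`RetractionSpecialization.exists_not_dvd_smul_eq_zero_of_isTorsion_quotSMulTop`), then the ideator g38's
`TelescopeK2PurityOfPTorsionPseudoNull.exists_span_C_pow_le_charIdeal_torsionBy_CX_of_pTolerant` (built on the LEAD g2's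
`TelescopeK2PurityOfNoPseudoNull.isPseudoNull_torsionBy_of_prime_of_not_dvd`: `X₂[C X]` is pseudo-null, hence `p^m`-torsion by W4⁰, finitely generated over
`ℤ_p⟦T⟧` by p751472's change of rings, so `(C p^{m n}) ⊆ char_Λ(X₂[C X])`). Conclusion = W4 `stub_weightTwoPurity` TOKEN FOR TOKEN. [folklore]
[cite: Greenberg2016Selmer, Prop. 4.1.1 (c) (shape only)] [cite: Washington1997, §13.2] -/
theorem weightTwoPurity_of_pTolerant
    (h2 : type_of% stub_weightTwoControlMap)
    (h3 :
    ∀ (W : WeierstrassCurve ℚ) [W.IsElliptic] [W.IsGloballyMinimal] (p : ℕ) [Fact p.Prime],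
    ∀ (N : ℕ) [NeZero N] (K : Type) [Field K] [NumberField K] (Dt : ModularParametrizationData W N)
      (H : HeegnerDatum N (NumberField.discr K)) (ιK : K →+* ℂ) (P : (W.baseChange K).toAffine.Point),
      CellC W p → W.conductorNorm ℤ = N →
      IsImaginaryQuadratic K → NumberField.discr K < -4 → SatisfiesHeegnerHypothesis N K →
      (W.quadraticTwist (NumberField.discr K : ℚ)).entireLFunction 1 ≠ 0 →
      WeierstrassCurve.Affine.Point.map ιK.toRatAlgHom P = heegnerPointComplex Dt H →
      ¬ (p : ℤ) ∣ Dt.c → ¬ IsOfFinAddOrder P →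
      Odd (NumberField.discr K) →
      ∀ (κ : ZpExtension K p), κ.IsAnticyclotomic →
        ∀ (γ : Field.absoluteGaloisGroup K) [Fact (κ.IsTopGenerator γ)]
          (𝔭 : HeightOneSpectrum (𝓞 K)), ((p : ℕ) : 𝓞 K) ∈ 𝔭.asIdeal →
          𝔭.asIdeal.ramificationIdx (𝓞 ℚ) = 1 → 𝔭.asIdeal.inertiaDeg (𝓞 ℚ) = 1 →
          ∀ (𝔭bar : HeightOneSpectrum (𝓞 K)), ((p : ℕ) : 𝓞 K) ∈ 𝔭bar.asIdeal → 𝔭bar ≠ 𝔭 →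
            ((Ideal.span {(p : ℤ)}).primesOver (𝓞 K)).ncard = 2 →
          ∀ (f : CuspForm (CongruenceSubgroup.Gamma0 N) 2), IsNewformOf W f →
            ∀ (ι' : PadicAlgCl p ≃+* ℂ),
              (∀ (w : InfinitePlace K) (k : 𝓞 K),
                k ∈ 𝔭.asIdeal ↔ ‖ι'.symm (w.embedding (k : K))‖ < 1) →
              ∀ (ΩK : ℂ) (Ωp : ℂ_[p]) (Q : PowerSeries 𝓞_ℂ_[p]), ΩK ≠ 0 → ‖Ωp‖ = 1 →
                R1.IsBDPLFunctionInt p ι' 𝔭 κ γ f ΩK Ωp Q →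
      ∀ (L : PowerSeries (PowerSeries (unrIntegers p))) (x : ℕ → ℤ_[p]) (D : ℕ → Skinner2016.HidaCongruentForm W p 1),
        (∀ k, ‖x k‖ < 1) ∧ Filter.Tendsto x Filter.atTop (nhds 0) ∧
        (∃ e : ℕ, PowerSeries.C ((p : 𝓞_ℂ_[p]) ^ e) * Q ∈
          Ideal.span {PowerSeries.map (R1.unrToCpInt p) (PowerSeries.map (PowerSeries.constantCoeff (R := unrIntegers p)) L)}) ∧
        (∀ k : ℕ, (∀ y : coeffField (D k).g, ι' ((D k).ι y) = (y : ℂ)) ∧ 2 * ((p : ℤ) - 1) ∣ (D k).k - 2 ∧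
          ∃ (ΩKg : ℂ) (Ωpg : ℂ_[p]) (Lg : UnrSeries p), ΩKg ≠ 0 ∧ ‖Ωpg‖ = 1 ∧
            IsBDPLFunctionWt ι' 𝔭 κ γ (D k).g ΩKg Ωpg Lg ∧
          ∃ Ψ : UnrSeries p,
            (∃ U : PowerSeries (PowerSeries (unrIntegers p)),
              PowerSeries.map (PowerSeries.C (R := unrIntegers p)) Ψ =
                L + PowerSeries.C (PowerSeries.X - PowerSeries.C (toUnr p (x k))) * U) ∧
            (∃ e : ℕ, PowerSeries.C ((p : 𝓞_ℂ_[p]) ^ e) * PowerSeries.map (R1.unrToCpInt p) Ψ ∈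
              Ideal.span {PowerSeries.map (R1.unrToCpInt p) Lg})) ∧
        (∃ A : ℕ → UnrSeries p, ∀ ℓ : ℕ, ℓ.Prime → ¬ ℓ ∣ N →
          (∃ U : UnrSeries p, A ℓ = PowerSeries.C (toUnr p ((W.frobeniusTrace ℓ : ℤ) : ℤ_[p])) + PowerSeries.X * U) ∧
          ∀ k : ℕ, ∃ (c : unrIntegers p) (U : UnrSeries p),
            A ℓ = PowerSeries.C c + (PowerSeries.X - PowerSeries.C (toUnr p (x k))) * U ∧
            ((c : ℂ_[p]) = algebraMap (PadicAlgCl p) ℂ_[p]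
              ((D k).ι ⟨(UpperHalfPlane.qExpansion 1 ⇑(D k).g).coeff ℓ, coeff_mem_coeffField (D k).g ℓ⟩))) →
      ∀ [TopologicalSpace (PowerSeries ℤ_[p])] (A₂ : Type) [AddCommGroup A₂]
        [Module (PowerSeries ℤ_[p]) A₂] [TopologicalSpace A₂] [DiscreteTopology A₂]
        (ρ₂ : ContinuousRep (Field.absoluteGaloisGroup K) (PowerSeries ℤ_[p]) A₂)
        [TopologicalSpace (PowerSeries (PowerSeries ℤ_[p]))]
        [ContinuousSMul (PowerSeries (PowerSeries ℤ_[p])) (BigRepModule (PowerSeries ℤ_[p]) p A₂)]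
        [Module (PowerSeries ℤ_[p]) (XBig κ ρ₂ 𝔭bar (∅ : Set (HeightOneSpectrum (𝓞 K))))]
        [IsScalarTower (PowerSeries ℤ_[p]) (PowerSeries (PowerSeries ℤ_[p]))
          (XBig κ ρ₂ 𝔭bar (∅ : Set (HeightOneSpectrum (𝓞 K))))],
        ((∀ a : A₂, ∃ n : ℕ, (PowerSeries.X : PowerSeries ℤ_[p]) ^ n • a = 0) ∧
          (∀ a : A₂, ∃ b : A₂, (PowerSeries.X : PowerSeries ℤ_[p]) • b = a) ∧
          (∀ (k : ℕ) (a : A₂), ∃ b : A₂, (PowerSeries.X - PowerSeries.C (x k)) • b = a) ∧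
          (∃ S₀ : Set (HeightOneSpectrum (𝓞 K)), S₀.Finite ∧ GaloisRep.IsUnramifiedOutside S₀ ρ₂) ∧
          (∃ θ₀ : Submodule.torsionBy (PowerSeries ℤ_[p]) A₂ (PowerSeries.X : PowerSeries ℤ_[p]) →+
              PrimaryTorsion (W.baseChange K).geomPoints p,
            (∀ (c : ℤ_[p]) (a : Submodule.torsionBy (PowerSeries ℤ_[p]) A₂ (PowerSeries.X : PowerSeries ℤ_[p])),
                θ₀ (PowerSeries.C c • a) = c • θ₀ a) ∧
            (∀ (σ : Field.absoluteGaloisGroup K)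
                (a : Submodule.torsionBy (PowerSeries ℤ_[p]) A₂ (PowerSeries.X : PowerSeries ℤ_[p])),
                θ₀ (BigGaloisRep.torsionRep ρ₂ (PowerSeries.X : PowerSeries ℤ_[p]) σ a) =
                  (W.baseChange K).primaryTorsionGaloisRep p σ (θ₀ a)) ∧
            Finite θ₀.ker ∧ Finite (PrimaryTorsion (W.baseChange K).geomPoints p ⧸ θ₀.range)) ∧
          (∀ k : ℕ, Function.Surjective (algebraMap ℤ_[p] (padicCoeffIntegers (D k).ι)) ∧
            ∃ θ : Submodule.torsionBy (PowerSeries ℤ_[p]) A₂ (PowerSeries.X - PowerSeries.C (x k)) →+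
                Cofree (D k).Δ.selfDualRep (padicCoeffField (D k).ι),
              (∀ (c : ℤ_[p])
                  (a : Submodule.torsionBy (PowerSeries ℤ_[p]) A₂ (PowerSeries.X - PowerSeries.C (x k))),
                  θ (PowerSeries.C c • a) = algebraMap ℤ_[p] (padicCoeffIntegers (D k).ι) c • θ a) ∧
              (∀ (σ : Field.absoluteGaloisGroup K)
                  (a : Submodule.torsionBy (PowerSeries ℤ_[p]) A₂ (PowerSeries.X - PowerSeries.C (x k))),
                  θ (BigGaloisRep.torsionRep ρ₂ (PowerSeries.X - PowerSeries.C (x k)) σ a) =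
                    (D k).Δ.selfDualCofreeRepOver K σ (θ a)) ∧
              Finite θ.ker ∧ Finite (Cofree (D k).Δ.selfDualRep (padicCoeffField (D k).ι) ⧸ θ.range))) →
        ∀ [Module (PowerSeries ℤ_[p]) (CharacterModule (TorsionControl.selmer (localMap K) (strictSet p 𝔭bar (∅ : Set (HeightOneSpectrum (𝓞 K))))
            (TorsionControl.torsionRep (AnticyclotomicBigGaloisRep κ ρ₂) (PowerSeries.C (PowerSeries.X : PowerSeries ℤ_[p])))))]
          [IsScalarTower (PowerSeries ℤ_[p]) (PowerSeries (PowerSeries ℤ_[p]))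
            (CharacterModule (TorsionControl.selmer (localMap K) (strictSet p 𝔭bar (∅ : Set (HeightOneSpectrum (𝓞 K))))
            (TorsionControl.torsionRep (AnticyclotomicBigGaloisRep κ ρ₂) (PowerSeries.C (PowerSeries.X : PowerSeries ℤ_[p])))))],
          Module.Finite (PowerSeries ℤ_[p]) (CharacterModule (TorsionControl.selmer (localMap K) (strictSet p 𝔭bar (∅ : Set (HeightOneSpectrum (𝓞 K))))
            (TorsionControl.torsionRep (AnticyclotomicBigGaloisRep κ ρ₂) (PowerSeries.C (PowerSeries.X : PowerSeries ℤ_[p]))))) ∧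
          Module.IsTorsion (PowerSeries ℤ_[p]) (CharacterModule (TorsionControl.selmer (localMap K) (strictSet p 𝔭bar (∅ : Set (HeightOneSpectrum (𝓞 K))))
            (TorsionControl.torsionRep (AnticyclotomicBigGaloisRep κ ρ₂) (PowerSeries.C (PowerSeries.X : PowerSeries ℤ_[p]))))) ∧
          (∃ e : ℕ, Ideal.span {PowerSeries.C ((p : ℤ_[p]) ^ e)} *
              Literature.NumberTheory.EllipticCurves.Module.charIdeal (PowerSeries ℤ_[p])
                (CharacterModule (TorsionControl.selmer (localMap K) (strictSet p 𝔭bar (∅ : Set (HeightOneSpectrum (𝓞 K))))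
            (TorsionControl.torsionRep (AnticyclotomicBigGaloisRep κ ρ₂) (PowerSeries.C (PowerSeries.X : PowerSeries ℤ_[p]))))) ≤
            XAc.charIdeal (W.baseChange K) p κ 𝔭bar ∅ γ))
    (h4' : type_of% stub_bigPseudoNullPTorsion) :
    ∀ (W : WeierstrassCurve ℚ) [W.IsElliptic] [W.IsGloballyMinimal] (p : ℕ) [Fact p.Prime],
    ∀ (N : ℕ) [NeZero N] (K : Type) [Field K] [NumberField K] (Dt : ModularParametrizationData W N)
      (H : HeegnerDatum N (NumberField.discr K)) (ιK : K →+* ℂ) (P : (W.baseChange K).toAffine.Point),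
      CellC W p → W.conductorNorm ℤ = N →
      IsImaginaryQuadratic K → NumberField.discr K < -4 → SatisfiesHeegnerHypothesis N K →
      (W.quadraticTwist (NumberField.discr K : ℚ)).entireLFunction 1 ≠ 0 →
      WeierstrassCurve.Affine.Point.map ιK.toRatAlgHom P = heegnerPointComplex Dt H →
      ¬ (p : ℤ) ∣ Dt.c → ¬ IsOfFinAddOrder P →
      Odd (NumberField.discr K) →
      ∀ (κ : ZpExtension K p), κ.IsAnticyclotomic →
        ∀ (γ : Field.absoluteGaloisGroup K) [Fact (κ.IsTopGenerator γ)]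
          (𝔭 : HeightOneSpectrum (𝓞 K)), ((p : ℕ) : 𝓞 K) ∈ 𝔭.asIdeal →
          𝔭.asIdeal.ramificationIdx (𝓞 ℚ) = 1 → 𝔭.asIdeal.inertiaDeg (𝓞 ℚ) = 1 →
          ∀ (𝔭bar : HeightOneSpectrum (𝓞 K)), ((p : ℕ) : 𝓞 K) ∈ 𝔭bar.asIdeal → 𝔭bar ≠ 𝔭 →
            ((Ideal.span {(p : ℤ)}).primesOver (𝓞 K)).ncard = 2 →
          ∀ (f : CuspForm (CongruenceSubgroup.Gamma0 N) 2), IsNewformOf W f →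
            ∀ (ι' : PadicAlgCl p ≃+* ℂ),
              (∀ (w : InfinitePlace K) (k : 𝓞 K),
                k ∈ 𝔭.asIdeal ↔ ‖ι'.symm (w.embedding (k : K))‖ < 1) →
              ∀ (ΩK : ℂ) (Ωp : ℂ_[p]) (Q : PowerSeries 𝓞_ℂ_[p]), ΩK ≠ 0 → ‖Ωp‖ = 1 →
                R1.IsBDPLFunctionInt p ι' 𝔭 κ γ f ΩK Ωp Q →
      ∀ (L : PowerSeries (PowerSeries (unrIntegers p))) (x : ℕ → ℤ_[p]) (D : ℕ → Skinner2016.HidaCongruentForm W p 1),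
        (∀ k, ‖x k‖ < 1) ∧ Filter.Tendsto x Filter.atTop (nhds 0) ∧
        (∃ e : ℕ, PowerSeries.C ((p : 𝓞_ℂ_[p]) ^ e) * Q ∈
          Ideal.span {PowerSeries.map (R1.unrToCpInt p) (PowerSeries.map (PowerSeries.constantCoeff (R := unrIntegers p)) L)}) ∧
        (∀ k : ℕ, (∀ y : coeffField (D k).g, ι' ((D k).ι y) = (y : ℂ)) ∧ 2 * ((p : ℤ) - 1) ∣ (D k).k - 2 ∧
          ∃ (ΩKg : ℂ) (Ωpg : ℂ_[p]) (Lg : UnrSeries p), ΩKg ≠ 0 ∧ ‖Ωpg‖ = 1 ∧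
            IsBDPLFunctionWt ι' 𝔭 κ γ (D k).g ΩKg Ωpg Lg ∧
          ∃ Ψ : UnrSeries p,
            (∃ U : PowerSeries (PowerSeries (unrIntegers p)),
              PowerSeries.map (PowerSeries.C (R := unrIntegers p)) Ψ =
                L + PowerSeries.C (PowerSeries.X - PowerSeries.C (toUnr p (x k))) * U) ∧
            (∃ e : ℕ, PowerSeries.C ((p : 𝓞_ℂ_[p]) ^ e) * PowerSeries.map (R1.unrToCpInt p) Ψ ∈
              Ideal.span {PowerSeries.map (R1.unrToCpInt p) Lg})) ∧
        (∃ A : ℕ → UnrSeries p, ∀ ℓ : ℕ, ℓ.Prime → ¬ ℓ ∣ N →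
          (∃ U : UnrSeries p, A ℓ = PowerSeries.C (toUnr p ((W.frobeniusTrace ℓ : ℤ) : ℤ_[p])) + PowerSeries.X * U) ∧
          ∀ k : ℕ, ∃ (c : unrIntegers p) (U : UnrSeries p),
            A ℓ = PowerSeries.C c + (PowerSeries.X - PowerSeries.C (toUnr p (x k))) * U ∧
            ((c : ℂ_[p]) = algebraMap (PadicAlgCl p) ℂ_[p]
              ((D k).ι ⟨(UpperHalfPlane.qExpansion 1 ⇑(D k).g).coeff ℓ, coeff_mem_coeffField (D k).g ℓ⟩))) →
      ∀ [TopologicalSpace (PowerSeries ℤ_[p])] (A₂ : Type) [AddCommGroup A₂]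
        [Module (PowerSeries ℤ_[p]) A₂] [TopologicalSpace A₂] [DiscreteTopology A₂]
        (ρ₂ : ContinuousRep (Field.absoluteGaloisGroup K) (PowerSeries ℤ_[p]) A₂)
        [TopologicalSpace (PowerSeries (PowerSeries ℤ_[p]))]
        [ContinuousSMul (PowerSeries (PowerSeries ℤ_[p])) (BigRepModule (PowerSeries ℤ_[p]) p A₂)]
        [Module (PowerSeries ℤ_[p]) (XBig κ ρ₂ 𝔭bar (∅ : Set (HeightOneSpectrum (𝓞 K))))]
        [IsScalarTower (PowerSeries ℤ_[p]) (PowerSeries (PowerSeries ℤ_[p]))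
          (XBig κ ρ₂ 𝔭bar (∅ : Set (HeightOneSpectrum (𝓞 K))))],
        ((∀ a : A₂, ∃ n : ℕ, (PowerSeries.X : PowerSeries ℤ_[p]) ^ n • a = 0) ∧
          (∀ a : A₂, ∃ b : A₂, (PowerSeries.X : PowerSeries ℤ_[p]) • b = a) ∧
          (∀ (k : ℕ) (a : A₂), ∃ b : A₂, (PowerSeries.X - PowerSeries.C (x k)) • b = a) ∧
          (∃ S₀ : Set (HeightOneSpectrum (𝓞 K)), S₀.Finite ∧ GaloisRep.IsUnramifiedOutside S₀ ρ₂) ∧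
          (∃ θ₀ : Submodule.torsionBy (PowerSeries ℤ_[p]) A₂ (PowerSeries.X : PowerSeries ℤ_[p]) →+
              PrimaryTorsion (W.baseChange K).geomPoints p,
            (∀ (c : ℤ_[p]) (a : Submodule.torsionBy (PowerSeries ℤ_[p]) A₂ (PowerSeries.X : PowerSeries ℤ_[p])),
                θ₀ (PowerSeries.C c • a) = c • θ₀ a) ∧
            (∀ (σ : Field.absoluteGaloisGroup K)
                (a : Submodule.torsionBy (PowerSeries ℤ_[p]) A₂ (PowerSeries.X : PowerSeries ℤ_[p])),
                θ₀ (BigGaloisRep.torsionRep ρ₂ (PowerSeries.X : PowerSeries ℤ_[p]) σ a) =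
                  (W.baseChange K).primaryTorsionGaloisRep p σ (θ₀ a)) ∧
            Finite θ₀.ker ∧ Finite (PrimaryTorsion (W.baseChange K).geomPoints p ⧸ θ₀.range)) ∧
          (∀ k : ℕ, Function.Surjective (algebraMap ℤ_[p] (padicCoeffIntegers (D k).ι)) ∧
            ∃ θ : Submodule.torsionBy (PowerSeries ℤ_[p]) A₂ (PowerSeries.X - PowerSeries.C (x k)) →+
                Cofree (D k).Δ.selfDualRep (padicCoeffField (D k).ι),
              (∀ (c : ℤ_[p])
                  (a : Submodule.torsionBy (PowerSeries ℤ_[p]) A₂ (PowerSeries.X - PowerSeries.C (x k))),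
                  θ (PowerSeries.C c • a) = algebraMap ℤ_[p] (padicCoeffIntegers (D k).ι) c • θ a) ∧
              (∀ (σ : Field.absoluteGaloisGroup K)
                  (a : Submodule.torsionBy (PowerSeries ℤ_[p]) A₂ (PowerSeries.X - PowerSeries.C (x k))),
                  θ (BigGaloisRep.torsionRep ρ₂ (PowerSeries.X - PowerSeries.C (x k)) σ a) =
                    (D k).Δ.selfDualCofreeRepOver K σ (θ a)) ∧
              Finite θ.ker ∧ Finite (Cofree (D k).Δ.selfDualRep (padicCoeffField (D k).ι) ⧸ θ.range))) →
        ∃ m : ℕ, Ideal.span {PowerSeries.C ((p : ℤ_[p]) ^ m)} ≤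
          Literature.NumberTheory.EllipticCurves.Module.charIdeal (PowerSeries ℤ_[p])
            (Submodule.torsionBy (PowerSeries (PowerSeries ℤ_[p]))
              (XBig κ ρ₂ 𝔭bar (∅ : Set (HeightOneSpectrum (𝓞 K))))
              (PowerSeries.C (PowerSeries.X : PowerSeries ℤ_[p]))) := by
  intro W _ _ p _ N _ K _ _ Dt H ιK P hC hN hK hdisc hHeeg hL1 hP hc hfin hodd κ hκ γ _ 𝔭 h𝔭 hram hdeg 𝔭bar
    h𝔭bar hne hsp f hf ι' hι' ΩK Ωp Q hΩK hΩp hQ L x D hpkg _ A₂ _ _ _ _ ρ₂ _ _ _ _ hFD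
  -- (fg) = W1
  have hfg := bigModuleFinite W p N K Dt H ιK P hC hN hK hdisc hHeeg hL1 hP hc hfin hodd κ hκ γ 𝔭 h𝔭 hram hdeg 𝔭bar
    h𝔭bar hne hsp f hf ι' hι' ΩK Ωp Q hΩK hΩp hQ L x D hpkg A₂ ρ₂ hFD
  haveI : Module.Finite (PowerSeries (PowerSeries ℤ_[p])) (XBig κ ρ₂ 𝔭bar (∅ : Set (HeightOneSpectrum (𝓞 K)))) := hfg
  -- W2: the control map
  obtain ⟨α, hkerα, -⟩ := h2 W p N K Dt H ιK P hC hN hK hdisc hHeeg hL1 hP hc hfin hodd κ hκ γ 𝔭 h𝔭 hram hdeg 𝔭bar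
    h𝔭bar hne hsp f hf ι' hι' ΩK Ωp Q hΩK hΩp hQ L x D hpkg A₂ ρ₂ hFD
  -- the `Λ`-structure on `Y` through `Λ → B` (the only one compatible with the `B`-structure)
  letI instΛY : Module (PowerSeries ℤ_[p]) (CharacterModule (TorsionControl.selmer (localMap K) (strictSet p 𝔭bar (∅ : Set (HeightOneSpectrum (𝓞 K))))
            (TorsionControl.torsionRep (AnticyclotomicBigGaloisRep κ ρ₂) (PowerSeries.C (PowerSeries.X : PowerSeries ℤ_[p]))))) :=
    Module.compHom _ (algebraMap (PowerSeries ℤ_[p]) (PowerSeries (PowerSeries ℤ_[p])))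
  haveI instTowY : IsScalarTower (PowerSeries ℤ_[p]) (PowerSeries (PowerSeries ℤ_[p]))
      (CharacterModule (TorsionControl.selmer (localMap K) (strictSet p 𝔭bar (∅ : Set (HeightOneSpectrum (𝓞 K))))
            (TorsionControl.torsionRep (AnticyclotomicBigGaloisRep κ ρ₂) (PowerSeries.C (PowerSeries.X : PowerSeries ℤ_[p]))))) :=
    ⟨fun a b y => by
      change (algebraMap (PowerSeries ℤ_[p]) (PowerSeries (PowerSeries ℤ_[p])) a * b) • y =
        algebraMap (PowerSeries ℤ_[p]) (PowerSeries (PowerSeries ℤ_[p])) a • (b • y)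
      exact mul_smul _ _ _⟩
  -- W3: the `E`-side, for this structure
  obtain ⟨hYfg, hYtor, -⟩ := h3 W p N K Dt H ιK P hC hN hK hdisc hHeeg hL1 hP hc hfin hodd κ hκ γ 𝔭 h𝔭 hram hdeg 𝔭bar
    h𝔭bar hne hsp f hf ι' hι' ΩK Ωp Q hΩK hΩp hQ L x D hpkg A₂ ρ₂ hFD
  haveI : Module.Finite (PowerSeries ℤ_[p]) (CharacterModule (TorsionControl.selmer (localMap K) (strictSet p 𝔭bar (∅ : Set (HeightOneSpectrum (𝓞 K))))
            (TorsionControl.torsionRep (AnticyclotomicBigGaloisRep κ ρ₂) (PowerSeries.C (PowerSeries.X : PowerSeries ℤ_[p]))))) := hYfg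
  -- the retraction `φ₀ = (X ↦ 0) : B → Λ`, kernel `(C X)`
  have hφ₀C : ∀ g : PowerSeries ℤ_[p],
      (PowerSeries.map (PowerSeries.constantCoeff (R := ℤ_[p])))
        (algebraMap (PowerSeries ℤ_[p]) (PowerSeries (PowerSeries ℤ_[p])) g) = g := by
    intro g
    change PowerSeries.map (PowerSeries.constantCoeff (R := ℤ_[p]))
      (PowerSeries.map (PowerSeries.C (R := ℤ_[p])) g) = g
    refine PowerSeries.ext fun n => ?_
    simp only [PowerSeries.coeff_map, PowerSeries.constantCoeff_C]
  have hφ₀π : (PowerSeries.map (PowerSeries.constantCoeff (R := ℤ_[p]))) (PowerSeries.C (PowerSeries.X : PowerSeries ℤ_[p])) = 0 := by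
    rw [PowerSeries.map_C, PowerSeries.constantCoeff_X, map_zero]
  have hφ₀ker : ∀ b : PowerSeries (PowerSeries ℤ_[p]),
      (PowerSeries.map (PowerSeries.constantCoeff (R := ℤ_[p]))) b = 0 → (PowerSeries.C (PowerSeries.X : PowerSeries ℤ_[p])) ∣ b :=
    fun b hb => C_X_dvd_of_map_constantCoeff_eq_zero b hb
  -- `Q := X₂/(C X)X₂` is finitely generated over `Λ`
  haveI hQfg : Module.Finite (PowerSeries ℤ_[p]) (QuotSMulTop (PowerSeries.C (PowerSeries.X : PowerSeries ℤ_[p])) (XBig κ ρ₂ 𝔭bar (∅ : Set (HeightOneSpectrum (𝓞 K))))) :=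
    RetractionSpecialization.moduleFinite_quotSMulTop_of_retraction hφ₀C hφ₀ker
  -- `α` read `Λ`-linearly
  let α' : QuotSMulTop (PowerSeries.C (PowerSeries.X : PowerSeries ℤ_[p])) (XBig κ ρ₂ 𝔭bar (∅ : Set (HeightOneSpectrum (𝓞 K)))) →ₗ[PowerSeries ℤ_[p]] (CharacterModule (TorsionControl.selmer (localMap K) (strictSet p 𝔭bar (∅ : Set (HeightOneSpectrum (𝓞 K))))
            (TorsionControl.torsionRep (AnticyclotomicBigGaloisRep κ ρ₂) (PowerSeries.C (PowerSeries.X : PowerSeries ℤ_[p]))))) := α.restrictScalars (PowerSeries ℤ_[p])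
  -- (reg₀), step 1: `Q` is `Λ`-torsion
  have hQtor : Module.IsTorsion (PowerSeries ℤ_[p]) (QuotSMulTop (PowerSeries.C (PowerSeries.X : PowerSeries ℤ_[p])) (XBig κ ρ₂ 𝔭bar (∅ : Set (HeightOneSpectrum (𝓞 K))))) := by
    intro q
    obtain ⟨⟨a, ha⟩, haq⟩ := @hYtor (α' q)
    have ha0 : a ≠ 0 := nonZeroDivisors.ne_zero ha
    have hmem : a • q ∈ LinearMap.ker α := by
      rw [LinearMap.mem_ker, ← algebraMap_smul (PowerSeries (PowerSeries ℤ_[p])) a q, map_smul,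
        algebraMap_smul]
      exact haq
    obtain ⟨s, hsπ, hs⟩ := hkerα _ hmem
    have hs0 : (PowerSeries.map (PowerSeries.constantCoeff (R := ℤ_[p]))) s ≠ 0 := fun h => hsπ (hφ₀ker s h)
    refine ⟨⟨(PowerSeries.map (PowerSeries.constantCoeff (R := ℤ_[p]))) s * a,
      mem_nonZeroDivisors_of_ne_zero (mul_ne_zero hs0 ha0)⟩, ?_⟩
    change ((PowerSeries.map (PowerSeries.constantCoeff (R := ℤ_[p]))) s * a) • q = 0
    -- `s ≡ φ₀ s (mod C X)` and `C X` kills `Q`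
    have hdiff : (s - algebraMap (PowerSeries ℤ_[p]) (PowerSeries (PowerSeries ℤ_[p]))
        ((PowerSeries.map (PowerSeries.constantCoeff (R := ℤ_[p]))) s)) • (a • q) = 0 :=
      RetractionSpecialization.smul_quotSMulTop_eq_zero' hφ₀ker _ _ (by rw [map_sub, hφ₀C, sub_self])
    rw [sub_smul, sub_eq_zero, algebraMap_smul] at hdiff
    rw [mul_smul, ← hdiff]
    exact hs
  -- (reg₀), step 2: the determinant trick (x2-p2 g18, by name)
  have hreg : ∃ s : PowerSeries (PowerSeries ℤ_[p]), ¬ ((PowerSeries.C (PowerSeries.X : PowerSeries ℤ_[p])) ∣ s) ∧ ∀ m : (XBig κ ρ₂ 𝔭bar (∅ : Set (HeightOneSpectrum (𝓞 K)))), s • m = 0 :=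
    RetractionSpecialization.exists_not_dvd_smul_eq_zero_of_isTorsion_quotSMulTop hφ₀C hφ₀π hφ₀ker hQtor
  -- W4⁰ at this `ρ₂`, then the `p`-tolerant purity algebra (ideator g38) on top of the LEAD g2's pseudo-nullity of `X₂[C X]`
  have h4'' := h4' W p N K Dt H ιK P hC hN hK hdisc hHeeg hL1 hP hc hfin hodd κ hκ γ 𝔭 h𝔭 hram hdeg 𝔭bar
    h𝔭bar hne hsp f hf ι' hι' ΩK Ωp Q hΩK hΩp hQ L x D hpkg A₂ ρ₂ hFD hfg hreg
  exact Summit.BirchSwinnertonDyer.BirchSwinnertonDyer.Theorems.TelescopeK2PurityOfPTorsionPseudoNull.exists_span_C_pow_le_charIdeal_torsionBy_CX_of_pTolerant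
    h4'' hreg


/-! ## §K Kernel (sorry-free): W1 → W2 → W3 → W4 → N2 -/

set_option maxHeartbeats 1600000 in
/-- **Kernel** `W1 → W2 → W3 → W4 → N2` (SORRY-FREE, pure module algebra BY NAME on p729686 / x2-p2's torsion file / p737674 / the tree's
`charIdeal` calculus). The conclusion is the statement of `K2Leaves.stub_weightTwoControl` (tree `Lines/telescopeK2leaves.lean` v1.0, l.207–289)
TOKEN FOR TOKEN. [folklore] -/
theorem weightTwoControl_of_subleaves
    (h1 : type_of% bigModuleFinite)
    (h2 : type_of% stub_weightTwoControlMap)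
    (h3 :
    ∀ (W : WeierstrassCurve ℚ) [W.IsElliptic] [W.IsGloballyMinimal] (p : ℕ) [Fact p.Prime],
    ∀ (N : ℕ) [NeZero N] (K : Type) [Field K] [NumberField K] (Dt : ModularParametrizationData W N)
      (H : HeegnerDatum N (NumberField.discr K)) (ιK : K →+* ℂ) (P : (W.baseChange K).toAffine.Point),
      CellC W p → W.conductorNorm ℤ = N →
      IsImaginaryQuadratic K → NumberField.discr K < -4 → SatisfiesHeegnerHypothesis N K →
      (W.quadraticTwist (NumberField.discr K : ℚ)).entireLFunction 1 ≠ 0 →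
      WeierstrassCurve.Affine.Point.map ιK.toRatAlgHom P = heegnerPointComplex Dt H →
      ¬ (p : ℤ) ∣ Dt.c → ¬ IsOfFinAddOrder P →
      Odd (NumberField.discr K) →
      ∀ (κ : ZpExtension K p), κ.IsAnticyclotomic →
        ∀ (γ : Field.absoluteGaloisGroup K) [Fact (κ.IsTopGenerator γ)]
          (𝔭 : HeightOneSpectrum (𝓞 K)), ((p : ℕ) : 𝓞 K) ∈ 𝔭.asIdeal →
          𝔭.asIdeal.ramificationIdx (𝓞 ℚ) = 1 → 𝔭.asIdeal.inertiaDeg (𝓞 ℚ) = 1 →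
          ∀ (𝔭bar : HeightOneSpectrum (𝓞 K)), ((p : ℕ) : 𝓞 K) ∈ 𝔭bar.asIdeal → 𝔭bar ≠ 𝔭 →
            ((Ideal.span {(p : ℤ)}).primesOver (𝓞 K)).ncard = 2 →
          ∀ (f : CuspForm (CongruenceSubgroup.Gamma0 N) 2), IsNewformOf W f →
            ∀ (ι' : PadicAlgCl p ≃+* ℂ),
              (∀ (w : InfinitePlace K) (k : 𝓞 K),
                k ∈ 𝔭.asIdeal ↔ ‖ι'.symm (w.embedding (k : K))‖ < 1) →
              ∀ (ΩK : ℂ) (Ωp : ℂ_[p]) (Q : PowerSeries 𝓞_ℂ_[p]), ΩK ≠ 0 → ‖Ωp‖ = 1 →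
                R1.IsBDPLFunctionInt p ι' 𝔭 κ γ f ΩK Ωp Q →
      ∀ (L : PowerSeries (PowerSeries (unrIntegers p))) (x : ℕ → ℤ_[p]) (D : ℕ → Skinner2016.HidaCongruentForm W p 1),
        (∀ k, ‖x k‖ < 1) ∧ Filter.Tendsto x Filter.atTop (nhds 0) ∧
        (∃ e : ℕ, PowerSeries.C ((p : 𝓞_ℂ_[p]) ^ e) * Q ∈
          Ideal.span {PowerSeries.map (R1.unrToCpInt p) (PowerSeries.map (PowerSeries.constantCoeff (R := unrIntegers p)) L)}) ∧
        (∀ k : ℕ, (∀ y : coeffField (D k).g, ι' ((D k).ι y) = (y : ℂ)) ∧ 2 * ((p : ℤ) - 1) ∣ (D k).k - 2 ∧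
          ∃ (ΩKg : ℂ) (Ωpg : ℂ_[p]) (Lg : UnrSeries p), ΩKg ≠ 0 ∧ ‖Ωpg‖ = 1 ∧
            IsBDPLFunctionWt ι' 𝔭 κ γ (D k).g ΩKg Ωpg Lg ∧
          ∃ Ψ : UnrSeries p,
            (∃ U : PowerSeries (PowerSeries (unrIntegers p)),
              PowerSeries.map (PowerSeries.C (R := unrIntegers p)) Ψ =
                L + PowerSeries.C (PowerSeries.X - PowerSeries.C (toUnr p (x k))) * U) ∧
            (∃ e : ℕ, PowerSeries.C ((p : 𝓞_ℂ_[p]) ^ e) * PowerSeries.map (R1.unrToCpInt p) Ψ ∈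
              Ideal.span {PowerSeries.map (R1.unrToCpInt p) Lg})) ∧
        (∃ A : ℕ → UnrSeries p, ∀ ℓ : ℕ, ℓ.Prime → ¬ ℓ ∣ N →
          (∃ U : UnrSeries p, A ℓ = PowerSeries.C (toUnr p ((W.frobeniusTrace ℓ : ℤ) : ℤ_[p])) + PowerSeries.X * U) ∧
          ∀ k : ℕ, ∃ (c : unrIntegers p) (U : UnrSeries p),
            A ℓ = PowerSeries.C c + (PowerSeries.X - PowerSeries.C (toUnr p (x k))) * U ∧
            ((c : ℂ_[p]) = algebraMap (PadicAlgCl p) ℂ_[p]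
              ((D k).ι ⟨(UpperHalfPlane.qExpansion 1 ⇑(D k).g).coeff ℓ, coeff_mem_coeffField (D k).g ℓ⟩))) →
      ∀ [TopologicalSpace (PowerSeries ℤ_[p])] (A₂ : Type) [AddCommGroup A₂]
        [Module (PowerSeries ℤ_[p]) A₂] [TopologicalSpace A₂] [DiscreteTopology A₂]
        (ρ₂ : ContinuousRep (Field.absoluteGaloisGroup K) (PowerSeries ℤ_[p]) A₂)
        [TopologicalSpace (PowerSeries (PowerSeries ℤ_[p]))]
        [ContinuousSMul (PowerSeries (PowerSeries ℤ_[p])) (BigRepModule (PowerSeries ℤ_[p]) p A₂)]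
        [Module (PowerSeries ℤ_[p]) (XBig κ ρ₂ 𝔭bar (∅ : Set (HeightOneSpectrum (𝓞 K))))]
        [IsScalarTower (PowerSeries ℤ_[p]) (PowerSeries (PowerSeries ℤ_[p]))
          (XBig κ ρ₂ 𝔭bar (∅ : Set (HeightOneSpectrum (𝓞 K))))],
        ((∀ a : A₂, ∃ n : ℕ, (PowerSeries.X : PowerSeries ℤ_[p]) ^ n • a = 0) ∧
          (∀ a : A₂, ∃ b : A₂, (PowerSeries.X : PowerSeries ℤ_[p]) • b = a) ∧
          (∀ (k : ℕ) (a : A₂), ∃ b : A₂, (PowerSeries.X - PowerSeries.C (x k)) • b = a) ∧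
          (∃ S₀ : Set (HeightOneSpectrum (𝓞 K)), S₀.Finite ∧ GaloisRep.IsUnramifiedOutside S₀ ρ₂) ∧
          (∃ θ₀ : Submodule.torsionBy (PowerSeries ℤ_[p]) A₂ (PowerSeries.X : PowerSeries ℤ_[p]) →+
              PrimaryTorsion (W.baseChange K).geomPoints p,
            (∀ (c : ℤ_[p]) (a : Submodule.torsionBy (PowerSeries ℤ_[p]) A₂ (PowerSeries.X : PowerSeries ℤ_[p])),
                θ₀ (PowerSeries.C c • a) = c • θ₀ a) ∧
            (∀ (σ : Field.absoluteGaloisGroup K)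
                (a : Submodule.torsionBy (PowerSeries ℤ_[p]) A₂ (PowerSeries.X : PowerSeries ℤ_[p])),
                θ₀ (BigGaloisRep.torsionRep ρ₂ (PowerSeries.X : PowerSeries ℤ_[p]) σ a) =
                  (W.baseChange K).primaryTorsionGaloisRep p σ (θ₀ a)) ∧
            Finite θ₀.ker ∧ Finite (PrimaryTorsion (W.baseChange K).geomPoints p ⧸ θ₀.range)) ∧
          (∀ k : ℕ, Function.Surjective (algebraMap ℤ_[p] (padicCoeffIntegers (D k).ι)) ∧
            ∃ θ : Submodule.torsionBy (PowerSeries ℤ_[p]) A₂ (PowerSeries.X - PowerSeries.C (x k)) →+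
                Cofree (D k).Δ.selfDualRep (padicCoeffField (D k).ι),
              (∀ (c : ℤ_[p])
                  (a : Submodule.torsionBy (PowerSeries ℤ_[p]) A₂ (PowerSeries.X - PowerSeries.C (x k))),
                  θ (PowerSeries.C c • a) = algebraMap ℤ_[p] (padicCoeffIntegers (D k).ι) c • θ a) ∧
              (∀ (σ : Field.absoluteGaloisGroup K)
                  (a : Submodule.torsionBy (PowerSeries ℤ_[p]) A₂ (PowerSeries.X - PowerSeries.C (x k))),
                  θ (BigGaloisRep.torsionRep ρ₂ (PowerSeries.X - PowerSeries.C (x k)) σ a) =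
                    (D k).Δ.selfDualCofreeRepOver K σ (θ a)) ∧
              Finite θ.ker ∧ Finite (Cofree (D k).Δ.selfDualRep (padicCoeffField (D k).ι) ⧸ θ.range))) →
        ∀ [Module (PowerSeries ℤ_[p]) (CharacterModule (TorsionControl.selmer (localMap K) (strictSet p 𝔭bar (∅ : Set (HeightOneSpectrum (𝓞 K))))
            (TorsionControl.torsionRep (AnticyclotomicBigGaloisRep κ ρ₂) (PowerSeries.C (PowerSeries.X : PowerSeries ℤ_[p])))))]
          [IsScalarTower (PowerSeries ℤ_[p]) (PowerSeries (PowerSeries ℤ_[p]))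
            (CharacterModule (TorsionControl.selmer (localMap K) (strictSet p 𝔭bar (∅ : Set (HeightOneSpectrum (𝓞 K))))
            (TorsionControl.torsionRep (AnticyclotomicBigGaloisRep κ ρ₂) (PowerSeries.C (PowerSeries.X : PowerSeries ℤ_[p])))))],
          Module.Finite (PowerSeries ℤ_[p]) (CharacterModule (TorsionControl.selmer (localMap K) (strictSet p 𝔭bar (∅ : Set (HeightOneSpectrum (𝓞 K))))
            (TorsionControl.torsionRep (AnticyclotomicBigGaloisRep κ ρ₂) (PowerSeries.C (PowerSeries.X : PowerSeries ℤ_[p]))))) ∧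
          Module.IsTorsion (PowerSeries ℤ_[p]) (CharacterModule (TorsionControl.selmer (localMap K) (strictSet p 𝔭bar (∅ : Set (HeightOneSpectrum (𝓞 K))))
            (TorsionControl.torsionRep (AnticyclotomicBigGaloisRep κ ρ₂) (PowerSeries.C (PowerSeries.X : PowerSeries ℤ_[p]))))) ∧
          (∃ e : ℕ, Ideal.span {PowerSeries.C ((p : ℤ_[p]) ^ e)} *
              Literature.NumberTheory.EllipticCurves.Module.charIdeal (PowerSeries ℤ_[p])
                (CharacterModule (TorsionControl.selmer (localMap K) (strictSet p 𝔭bar (∅ : Set (HeightOneSpectrum (𝓞 K))))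
            (TorsionControl.torsionRep (AnticyclotomicBigGaloisRep κ ρ₂) (PowerSeries.C (PowerSeries.X : PowerSeries ℤ_[p]))))) ≤
            XAc.charIdeal (W.baseChange K) p κ 𝔭bar ∅ γ))
    (h4 : type_of% stub_weightTwoPurity) :
    ∀ (W : WeierstrassCurve ℚ) [W.IsElliptic] [W.IsGloballyMinimal] (p : ℕ) [Fact p.Prime],
    ∀ (N : ℕ) [NeZero N] (K : Type) [Field K] [NumberField K] (Dt : ModularParametrizationData W N)
      (H : HeegnerDatum N (NumberField.discr K)) (ιK : K →+* ℂ) (P : (W.baseChange K).toAffine.Point),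
      CellC W p → W.conductorNorm ℤ = N →
      IsImaginaryQuadratic K → NumberField.discr K < -4 → SatisfiesHeegnerHypothesis N K →
      (W.quadraticTwist (NumberField.discr K : ℚ)).entireLFunction 1 ≠ 0 →
      WeierstrassCurve.Affine.Point.map ιK.toRatAlgHom P = heegnerPointComplex Dt H →
      ¬ (p : ℤ) ∣ Dt.c → ¬ IsOfFinAddOrder P →
      Odd (NumberField.discr K) →
      ∀ (κ : ZpExtension K p), κ.IsAnticyclotomic →
        ∀ (γ : Field.absoluteGaloisGroup K) [Fact (κ.IsTopGenerator γ)]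
          (𝔭 : HeightOneSpectrum (𝓞 K)), ((p : ℕ) : 𝓞 K) ∈ 𝔭.asIdeal →
          𝔭.asIdeal.ramificationIdx (𝓞 ℚ) = 1 → 𝔭.asIdeal.inertiaDeg (𝓞 ℚ) = 1 →
          ∀ (𝔭bar : HeightOneSpectrum (𝓞 K)), ((p : ℕ) : 𝓞 K) ∈ 𝔭bar.asIdeal → 𝔭bar ≠ 𝔭 →
            ((Ideal.span {(p : ℤ)}).primesOver (𝓞 K)).ncard = 2 →
          ∀ (f : CuspForm (CongruenceSubgroup.Gamma0 N) 2), IsNewformOf W f →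
            ∀ (ι' : PadicAlgCl p ≃+* ℂ),
              (∀ (w : InfinitePlace K) (k : 𝓞 K),
                k ∈ 𝔭.asIdeal ↔ ‖ι'.symm (w.embedding (k : K))‖ < 1) →
              ∀ (ΩK : ℂ) (Ωp : ℂ_[p]) (Q : PowerSeries 𝓞_ℂ_[p]), ΩK ≠ 0 → ‖Ωp‖ = 1 →
                R1.IsBDPLFunctionInt p ι' 𝔭 κ γ f ΩK Ωp Q →
      ∀ (L : PowerSeries (PowerSeries (unrIntegers p))) (x : ℕ → ℤ_[p]) (D : ℕ → Skinner2016.HidaCongruentForm W p 1),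
        (∀ k, ‖x k‖ < 1) ∧ Filter.Tendsto x Filter.atTop (nhds 0) ∧
        (∃ e : ℕ, PowerSeries.C ((p : 𝓞_ℂ_[p]) ^ e) * Q ∈
          Ideal.span {PowerSeries.map (R1.unrToCpInt p) (PowerSeries.map (PowerSeries.constantCoeff (R := unrIntegers p)) L)}) ∧
        (∀ k : ℕ, (∀ y : coeffField (D k).g, ι' ((D k).ι y) = (y : ℂ)) ∧ 2 * ((p : ℤ) - 1) ∣ (D k).k - 2 ∧
          ∃ (ΩKg : ℂ) (Ωpg : ℂ_[p]) (Lg : UnrSeries p), ΩKg ≠ 0 ∧ ‖Ωpg‖ = 1 ∧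
            IsBDPLFunctionWt ι' 𝔭 κ γ (D k).g ΩKg Ωpg Lg ∧
          ∃ Ψ : UnrSeries p,
            (∃ U : PowerSeries (PowerSeries (unrIntegers p)),
              PowerSeries.map (PowerSeries.C (R := unrIntegers p)) Ψ =
                L + PowerSeries.C (PowerSeries.X - PowerSeries.C (toUnr p (x k))) * U) ∧
            (∃ e : ℕ, PowerSeries.C ((p : 𝓞_ℂ_[p]) ^ e) * PowerSeries.map (R1.unrToCpInt p) Ψ ∈
              Ideal.span {PowerSeries.map (R1.unrToCpInt p) Lg})) ∧
        (∃ A : ℕ → UnrSeries p, ∀ ℓ : ℕ, ℓ.Prime → ¬ ℓ ∣ N →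
          (∃ U : UnrSeries p, A ℓ = PowerSeries.C (toUnr p ((W.frobeniusTrace ℓ : ℤ) : ℤ_[p])) + PowerSeries.X * U) ∧
          ∀ k : ℕ, ∃ (c : unrIntegers p) (U : UnrSeries p),
            A ℓ = PowerSeries.C c + (PowerSeries.X - PowerSeries.C (toUnr p (x k))) * U ∧
            ((c : ℂ_[p]) = algebraMap (PadicAlgCl p) ℂ_[p]
              ((D k).ι ⟨(UpperHalfPlane.qExpansion 1 ⇑(D k).g).coeff ℓ, coeff_mem_coeffField (D k).g ℓ⟩))) →
      ∀ [TopologicalSpace (PowerSeries ℤ_[p])] (A₂ : Type) [AddCommGroup A₂]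
        [Module (PowerSeries ℤ_[p]) A₂] [TopologicalSpace A₂] [DiscreteTopology A₂]
        (ρ₂ : ContinuousRep (Field.absoluteGaloisGroup K) (PowerSeries ℤ_[p]) A₂)
        [TopologicalSpace (PowerSeries (PowerSeries ℤ_[p]))]
        [ContinuousSMul (PowerSeries (PowerSeries ℤ_[p])) (BigRepModule (PowerSeries ℤ_[p]) p A₂)]
        [Module (PowerSeries ℤ_[p]) (XBig κ ρ₂ 𝔭bar (∅ : Set (HeightOneSpectrum (𝓞 K))))]
        [IsScalarTower (PowerSeries ℤ_[p]) (PowerSeries (PowerSeries ℤ_[p]))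
          (XBig κ ρ₂ 𝔭bar (∅ : Set (HeightOneSpectrum (𝓞 K))))],
        ((∀ a : A₂, ∃ n : ℕ, (PowerSeries.X : PowerSeries ℤ_[p]) ^ n • a = 0) ∧
          (∀ a : A₂, ∃ b : A₂, (PowerSeries.X : PowerSeries ℤ_[p]) • b = a) ∧
          (∀ (k : ℕ) (a : A₂), ∃ b : A₂, (PowerSeries.X - PowerSeries.C (x k)) • b = a) ∧
          (∃ S₀ : Set (HeightOneSpectrum (𝓞 K)), S₀.Finite ∧ GaloisRep.IsUnramifiedOutside S₀ ρ₂) ∧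
          (∃ θ₀ : Submodule.torsionBy (PowerSeries ℤ_[p]) A₂ (PowerSeries.X : PowerSeries ℤ_[p]) →+
              PrimaryTorsion (W.baseChange K).geomPoints p,
            (∀ (c : ℤ_[p]) (a : Submodule.torsionBy (PowerSeries ℤ_[p]) A₂ (PowerSeries.X : PowerSeries ℤ_[p])),
                θ₀ (PowerSeries.C c • a) = c • θ₀ a) ∧
            (∀ (σ : Field.absoluteGaloisGroup K)
                (a : Submodule.torsionBy (PowerSeries ℤ_[p]) A₂ (PowerSeries.X : PowerSeries ℤ_[p])),
                θ₀ (BigGaloisRep.torsionRep ρ₂ (PowerSeries.X : PowerSeries ℤ_[p]) σ a) =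
                  (W.baseChange K).primaryTorsionGaloisRep p σ (θ₀ a)) ∧
            Finite θ₀.ker ∧ Finite (PrimaryTorsion (W.baseChange K).geomPoints p ⧸ θ₀.range)) ∧
          (∀ k : ℕ, Function.Surjective (algebraMap ℤ_[p] (padicCoeffIntegers (D k).ι)) ∧
            ∃ θ : Submodule.torsionBy (PowerSeries ℤ_[p]) A₂ (PowerSeries.X - PowerSeries.C (x k)) →+
                Cofree (D k).Δ.selfDualRep (padicCoeffField (D k).ι),
              (∀ (c : ℤ_[p])
                  (a : Submodule.torsionBy (PowerSeries ℤ_[p]) A₂ (PowerSeries.X - PowerSeries.C (x k))),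
                  θ (PowerSeries.C c • a) = algebraMap ℤ_[p] (padicCoeffIntegers (D k).ι) c • θ a) ∧
              (∀ (σ : Field.absoluteGaloisGroup K)
                  (a : Submodule.torsionBy (PowerSeries ℤ_[p]) A₂ (PowerSeries.X - PowerSeries.C (x k))),
                  θ (BigGaloisRep.torsionRep ρ₂ (PowerSeries.X - PowerSeries.C (x k)) σ a) =
                    (D k).Δ.selfDualCofreeRepOver K σ (θ a)) ∧
              Finite θ.ker ∧ Finite (Cofree (D k).Δ.selfDualRep (padicCoeffField (D k).ι) ⧸ θ.range))) →
        Module.Finite (PowerSeries (PowerSeries ℤ_[p])) (XBig κ ρ₂ 𝔭bar (∅ : Set (HeightOneSpectrum (𝓞 K)))) ∧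
        (∃ s : PowerSeries (PowerSeries ℤ_[p]),
          ¬ (PowerSeries.C (PowerSeries.X : PowerSeries ℤ_[p]) ∣ s) ∧
            ∀ m : XBig κ ρ₂ 𝔭bar (∅ : Set (HeightOneSpectrum (𝓞 K))), s • m = 0) ∧
        (∃ j : ℕ, Ideal.span {PowerSeries.C ((p : ℤ_[p]) ^ j)} *
            (Literature.NumberTheory.EllipticCurves.Module.charIdeal (PowerSeries (PowerSeries ℤ_[p]))
                (XBig κ ρ₂ 𝔭bar (∅ : Set (HeightOneSpectrum (𝓞 K))))).map
              (PowerSeries.map (PowerSeries.constantCoeff (R := ℤ_[p]))) ≤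
          XAc.charIdeal (W.baseChange K) p κ 𝔭bar ∅ γ) := by
  intro W _ _ p _ N _ K _ _ Dt H ιK P hC hN hK hdisc hHeeg hL1 hP hc hfin hodd κ hκ γ _ 𝔭 h𝔭 hram hdeg 𝔭bar
    h𝔭bar hne hsp f hf ι' hι' ΩK Ωp Q hΩK hΩp hQ L x D hpkg _ A₂ _ _ _ _ ρ₂ _ _ _ _ hFD
  -- (fg) = W1
  have hfg := h1 W p N K Dt H ιK P hC hN hK hdisc hHeeg hL1 hP hc hfin hodd κ hκ γ 𝔭 h𝔭 hram hdeg 𝔭bar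
    h𝔭bar hne hsp f hf ι' hι' ΩK Ωp Q hΩK hΩp hQ L x D hpkg A₂ ρ₂ hFD
  haveI : Module.Finite (PowerSeries (PowerSeries ℤ_[p])) (XBig κ ρ₂ 𝔭bar (∅ : Set (HeightOneSpectrum (𝓞 K)))) := hfg
  -- W2: the control map
  obtain ⟨α, hkerα, hcokα⟩ := h2 W p N K Dt H ιK P hC hN hK hdisc hHeeg hL1 hP hc hfin hodd κ hκ γ 𝔭 h𝔭 hram hdeg 𝔭bar
    h𝔭bar hne hsp f hf ι' hι' ΩK Ωp Q hΩK hΩp hQ L x D hpkg A₂ ρ₂ hFD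
  -- W4: purity
  obtain ⟨m, hm⟩ := h4 W p N K Dt H ιK P hC hN hK hdisc hHeeg hL1 hP hc hfin hodd κ hκ γ 𝔭 h𝔭 hram hdeg 𝔭bar
    h𝔭bar hne hsp f hf ι' hι' ΩK Ωp Q hΩK hΩp hQ L x D hpkg A₂ ρ₂ hFD
  -- the `Λ`-structure on `Y` through `Λ → B` (the only one compatible with the `B`-structure)
  letI instΛY : Module (PowerSeries ℤ_[p]) (CharacterModule (TorsionControl.selmer (localMap K) (strictSet p 𝔭bar (∅ : Set (HeightOneSpectrum (𝓞 K))))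
            (TorsionControl.torsionRep (AnticyclotomicBigGaloisRep κ ρ₂) (PowerSeries.C (PowerSeries.X : PowerSeries ℤ_[p]))))) :=
    Module.compHom _ (algebraMap (PowerSeries ℤ_[p]) (PowerSeries (PowerSeries ℤ_[p])))
  haveI instTowY : IsScalarTower (PowerSeries ℤ_[p]) (PowerSeries (PowerSeries ℤ_[p]))
      (CharacterModule (TorsionControl.selmer (localMap K) (strictSet p 𝔭bar (∅ : Set (HeightOneSpectrum (𝓞 K))))
            (TorsionControl.torsionRep (AnticyclotomicBigGaloisRep κ ρ₂) (PowerSeries.C (PowerSeries.X : PowerSeries ℤ_[p]))))) :=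
    ⟨fun a b y => by
      change (algebraMap (PowerSeries ℤ_[p]) (PowerSeries (PowerSeries ℤ_[p])) a * b) • y =
        algebraMap (PowerSeries ℤ_[p]) (PowerSeries (PowerSeries ℤ_[p])) a • (b • y)
      exact mul_smul _ _ _⟩
  -- W3: the `E`-side, for this structure
  obtain ⟨hYfg, hYtor, e, he⟩ := h3 W p N K Dt H ιK P hC hN hK hdisc hHeeg hL1 hP hc hfin hodd κ hκ γ 𝔭 h𝔭 hram hdeg 𝔭bar
    h𝔭bar hne hsp f hf ι' hι' ΩK Ωp Q hΩK hΩp hQ L x D hpkg A₂ ρ₂ hFD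
  haveI : Module.Finite (PowerSeries ℤ_[p]) (CharacterModule (TorsionControl.selmer (localMap K) (strictSet p 𝔭bar (∅ : Set (HeightOneSpectrum (𝓞 K))))
            (TorsionControl.torsionRep (AnticyclotomicBigGaloisRep κ ρ₂) (PowerSeries.C (PowerSeries.X : PowerSeries ℤ_[p]))))) := hYfg
  -- the retraction `φ₀ = (X ↦ 0) : B → Λ`, kernel `(C X)`
  have hφ₀C : ∀ g : PowerSeries ℤ_[p],
      (PowerSeries.map (PowerSeries.constantCoeff (R := ℤ_[p])))
        (algebraMap (PowerSeries ℤ_[p]) (PowerSeries (PowerSeries ℤ_[p])) g) = g := by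
    intro g
    change PowerSeries.map (PowerSeries.constantCoeff (R := ℤ_[p]))
      (PowerSeries.map (PowerSeries.C (R := ℤ_[p])) g) = g
    refine PowerSeries.ext fun n => ?_
    simp only [PowerSeries.coeff_map, PowerSeries.constantCoeff_C]
  have hφ₀π : (PowerSeries.map (PowerSeries.constantCoeff (R := ℤ_[p]))) (PowerSeries.C (PowerSeries.X : PowerSeries ℤ_[p])) = 0 := by
    rw [PowerSeries.map_C, PowerSeries.constantCoeff_X, map_zero]
  have hφ₀ker : ∀ b : PowerSeries (PowerSeries ℤ_[p]),
      (PowerSeries.map (PowerSeries.constantCoeff (R := ℤ_[p]))) b = 0 → (PowerSeries.C (PowerSeries.X : PowerSeries ℤ_[p])) ∣ b :=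
    fun b hb => C_X_dvd_of_map_constantCoeff_eq_zero b hb
  have hπ₀0 : ((PowerSeries.C (PowerSeries.X : PowerSeries ℤ_[p])) : PowerSeries (PowerSeries ℤ_[p])) ≠ 0 := by
    intro h
    have h1 := congrArg (PowerSeries.constantCoeff (R := PowerSeries ℤ_[p])) h
    rw [PowerSeries.constantCoeff_C, map_zero] at h1
    exact PowerSeries.X_ne_zero h1
  -- `Q := X₂/(C X)X₂` is finitely generated over `Λ`
  haveI hQfg : Module.Finite (PowerSeries ℤ_[p]) (QuotSMulTop (PowerSeries.C (PowerSeries.X : PowerSeries ℤ_[p])) (XBig κ ρ₂ 𝔭bar (∅ : Set (HeightOneSpectrum (𝓞 K))))) :=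
    RetractionSpecialization.moduleFinite_quotSMulTop_of_retraction hφ₀C hφ₀ker
  -- `α` read `Λ`-linearly
  let α' : QuotSMulTop (PowerSeries.C (PowerSeries.X : PowerSeries ℤ_[p])) (XBig κ ρ₂ 𝔭bar (∅ : Set (HeightOneSpectrum (𝓞 K)))) →ₗ[PowerSeries ℤ_[p]] (CharacterModule (TorsionControl.selmer (localMap K) (strictSet p 𝔭bar (∅ : Set (HeightOneSpectrum (𝓞 K))))
            (TorsionControl.torsionRep (AnticyclotomicBigGaloisRep κ ρ₂) (PowerSeries.C (PowerSeries.X : PowerSeries ℤ_[p]))))) := α.restrictScalars (PowerSeries ℤ_[p])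
  -- (reg₀), step 1: `Q` is `Λ`-torsion
  have hQtor : Module.IsTorsion (PowerSeries ℤ_[p]) (QuotSMulTop (PowerSeries.C (PowerSeries.X : PowerSeries ℤ_[p])) (XBig κ ρ₂ 𝔭bar (∅ : Set (HeightOneSpectrum (𝓞 K))))) := by
    intro q
    obtain ⟨⟨a, ha⟩, haq⟩ := @hYtor (α' q)
    have ha0 : a ≠ 0 := nonZeroDivisors.ne_zero ha
    have hmem : a • q ∈ LinearMap.ker α := by
      rw [LinearMap.mem_ker, ← algebraMap_smul (PowerSeries (PowerSeries ℤ_[p])) a q, map_smul,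
        algebraMap_smul]
      exact haq
    obtain ⟨s, hsπ, hs⟩ := hkerα _ hmem
    have hs0 : (PowerSeries.map (PowerSeries.constantCoeff (R := ℤ_[p]))) s ≠ 0 := fun h => hsπ (hφ₀ker s h)
    refine ⟨⟨(PowerSeries.map (PowerSeries.constantCoeff (R := ℤ_[p]))) s * a,
      mem_nonZeroDivisors_of_ne_zero (mul_ne_zero hs0 ha0)⟩, ?_⟩
    change ((PowerSeries.map (PowerSeries.constantCoeff (R := ℤ_[p]))) s * a) • q = 0
    -- `s ≡ φ₀ s (mod C X)` and `C X` kills `Q`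
    have hdiff : (s - algebraMap (PowerSeries ℤ_[p]) (PowerSeries (PowerSeries ℤ_[p]))
        ((PowerSeries.map (PowerSeries.constantCoeff (R := ℤ_[p]))) s)) • (a • q) = 0 :=
      RetractionSpecialization.smul_quotSMulTop_eq_zero' hφ₀ker _ _ (by rw [map_sub, hφ₀C, sub_self])
    rw [sub_smul, sub_eq_zero, algebraMap_smul] at hdiff
    rw [mul_smul, ← hdiff]
    exact hs
  -- (reg₀), step 2: the determinant trick (x2-p2 g18, by name)
  have hreg : ∃ s : PowerSeries (PowerSeries ℤ_[p]), ¬ ((PowerSeries.C (PowerSeries.X : PowerSeries ℤ_[p])) ∣ s) ∧ ∀ m : (XBig κ ρ₂ 𝔭bar (∅ : Set (HeightOneSpectrum (𝓞 K)))), s • m = 0 :=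
    RetractionSpecialization.exists_not_dvd_smul_eq_zero_of_isTorsion_quotSMulTop hφ₀C hφ₀π hφ₀ker hQtor
  refine ⟨hfg, hreg, ?_⟩
  -- (div₀)
  obtain ⟨s₀, hs₀π, hs₀⟩ := hreg
  have hs₀' : ∃ s : PowerSeries (PowerSeries ℤ_[p]),
      (PowerSeries.map (PowerSeries.constantCoeff (R := ℤ_[p]))) s ≠ 0 ∧ ∀ m : (XBig κ ρ₂ 𝔭bar (∅ : Set (HeightOneSpectrum (𝓞 K)))), s • m = 0 :=
    ⟨s₀, fun h => hs₀π (hφ₀ker _ h), hs₀⟩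
  -- two-sided Herbrand at `X ↦ 0` (p729686, by name)
  haveI hufdB : UniqueFactorizationMonoid (PowerSeries (PowerSeries ℤ_[p])) :=
    Literature.NumberTheory.IwasawaTheory.uniqueFactorizationMonoid_powerSeries_powerSeries ℤ_[p]
  have hHer := RetractionSpecialization.charIdeal_quotSMulTop_eq_mul_of_retraction hφ₀C hφ₀π hφ₀ker hπ₀0
    (XBig κ ρ₂ 𝔭bar (∅ : Set (HeightOneSpectrum (𝓞 K)))) hs₀'
  -- `char_Λ(Q) ⊆ char_Λ(Y)` along `α'`
  have hQ : Literature.NumberTheory.EllipticCurves.Module.charIdeal (PowerSeries ℤ_[p]) (QuotSMulTop (PowerSeries.C (PowerSeries.X : PowerSeries ℤ_[p])) (XBig κ ρ₂ 𝔭bar (∅ : Set (HeightOneSpectrum (𝓞 K))))) ≤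
      Literature.NumberTheory.EllipticCurves.Module.charIdeal (PowerSeries ℤ_[p]) (LinearMap.range α') := by
    rw [Literature.NumberTheory.EllipticCurves.Module.charIdeal_eq_mul_of_exact hQtor
      (LinearMap.ker α'.rangeRestrict).subtype α'.rangeRestrict (Submodule.injective_subtype _)
      (LinearMap.surjective_rangeRestrict α') (LinearMap.exact_subtype_ker_map _)]
    exact Ideal.mul_le_left
  have hfinq : Finite ((CharacterModule (TorsionControl.selmer (localMap K) (strictSet p 𝔭bar (∅ : Set (HeightOneSpectrum (𝓞 K))))
            (TorsionControl.torsionRep (AnticyclotomicBigGaloisRep κ ρ₂) (PowerSeries.C (PowerSeries.X : PowerSeries ℤ_[p]))))) ⧸ LinearMap.range α') := by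
    have hr : LinearMap.range α' = (LinearMap.range α).restrictScalars (PowerSeries ℤ_[p]) :=
      LinearMap.range_restrictScalars α
    rw [hr]
    exact Finite.of_equiv _ (Submodule.Quotient.restrictScalarsEquiv (PowerSeries ℤ_[p]) (LinearMap.range α)).symm.toEquiv
  haveI := hfinq
  have htop : Literature.NumberTheory.EllipticCurves.Module.charIdeal (PowerSeries ℤ_[p])
      ((CharacterModule (TorsionControl.selmer (localMap K) (strictSet p 𝔭bar (∅ : Set (HeightOneSpectrum (𝓞 K))))
            (TorsionControl.torsionRep (AnticyclotomicBigGaloisRep κ ρ₂) (PowerSeries.C (PowerSeries.X : PowerSeries ℤ_[p]))))) ⧸ LinearMap.range α') = ⊤ :=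
    Literature.NumberTheory.EllipticCurves.Module.charIdeal_eq_top_of_isPseudoNull
      (Literature.NumberTheory.EllipticCurves.isPseudoNull_of_finite p
        ((CharacterModule (TorsionControl.selmer (localMap K) (strictSet p 𝔭bar (∅ : Set (HeightOneSpectrum (𝓞 K))))
            (TorsionControl.torsionRep (AnticyclotomicBigGaloisRep κ ρ₂) (PowerSeries.C (PowerSeries.X : PowerSeries ℤ_[p]))))) ⧸ LinearMap.range α'))
  have hY : Literature.NumberTheory.EllipticCurves.Module.charIdeal (PowerSeries ℤ_[p]) (LinearMap.range α') =
      Literature.NumberTheory.EllipticCurves.Module.charIdeal (PowerSeries ℤ_[p]) (CharacterModule (TorsionControl.selmer (localMap K) (strictSet p 𝔭bar (∅ : Set (HeightOneSpectrum (𝓞 K))))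
            (TorsionControl.torsionRep (AnticyclotomicBigGaloisRep κ ρ₂) (PowerSeries.C (PowerSeries.X : PowerSeries ℤ_[p]))))) := by
    rw [Literature.NumberTheory.EllipticCurves.Module.charIdeal_eq_mul_of_exact hYtor
      (LinearMap.range α').subtype (LinearMap.range α').mkQ (Submodule.injective_subtype _)
      (Submodule.mkQ_surjective _) (LinearMap.exact_subtype_mkQ _), htop, Ideal.mul_top]
  -- assemble: `(p^(e+m))·φ₀(char_B X₂) ⊆ (p^e)·char_Λ(Q) ⊆ (p^e)·char_Λ(Y) ⊆ Ch_Λ(X_ac)`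
  refine ⟨e + m, ?_⟩
  have hsplit : Ideal.span {PowerSeries.C ((p : ℤ_[p]) ^ (e + m))} =
      Ideal.span {PowerSeries.C ((p : ℤ_[p]) ^ e)} * Ideal.span {PowerSeries.C ((p : ℤ_[p]) ^ m)} := by
    rw [Ideal.span_singleton_mul_span_singleton, ← map_mul, ← pow_add]
  rw [hsplit, mul_assoc]
  refine le_trans (Ideal.mul_mono_right ?_) he
  calc Ideal.span {PowerSeries.C ((p : ℤ_[p]) ^ m)} *
        (Literature.NumberTheory.EllipticCurves.Module.charIdeal (PowerSeries (PowerSeries ℤ_[p])) (XBig κ ρ₂ 𝔭bar (∅ : Set (HeightOneSpectrum (𝓞 K))))).map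
          (PowerSeries.map (PowerSeries.constantCoeff (R := ℤ_[p])))
      ≤ Literature.NumberTheory.EllipticCurves.Module.charIdeal (PowerSeries ℤ_[p])
            (Submodule.torsionBy (PowerSeries (PowerSeries ℤ_[p])) (XBig κ ρ₂ 𝔭bar (∅ : Set (HeightOneSpectrum (𝓞 K)))) (PowerSeries.C (PowerSeries.X : PowerSeries ℤ_[p]))) *
          (Literature.NumberTheory.EllipticCurves.Module.charIdeal (PowerSeries (PowerSeries ℤ_[p])) (XBig κ ρ₂ 𝔭bar (∅ : Set (HeightOneSpectrum (𝓞 K))))).map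
            (PowerSeries.map (PowerSeries.constantCoeff (R := ℤ_[p]))) := Ideal.mul_mono_left hm
    _ = Literature.NumberTheory.EllipticCurves.Module.charIdeal (PowerSeries ℤ_[p]) (QuotSMulTop (PowerSeries.C (PowerSeries.X : PowerSeries ℤ_[p])) (XBig κ ρ₂ 𝔭bar (∅ : Set (HeightOneSpectrum (𝓞 K))))) := hHer.symm
    _ ≤ Literature.NumberTheory.EllipticCurves.Module.charIdeal (PowerSeries ℤ_[p]) (LinearMap.range α') := hQ
    _ = Literature.NumberTheory.EllipticCurves.Module.charIdeal (PowerSeries ℤ_[p]) (CharacterModule (TorsionControl.selmer (localMap K) (strictSet p 𝔭bar (∅ : Set (HeightOneSpectrum (𝓞 K))))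
            (TorsionControl.torsionRep (AnticyclotomicBigGaloisRep κ ρ₂) (PowerSeries.C (PowerSeries.X : PowerSeries ℤ_[p]))))) := hY

/-! ## §K′ Kernel under PUB (v1.1, sorry-free): W2 → ((PUB) → (I-E)) → W4 → v10 `stub_weightTwoControlOfPub` -/

set_option maxHeartbeats 1600000 in
/-- **Kernel v1.1** `W2 → stub_ESideOfPub → W4 → <telescope v10 stub_weightTwoControlOfPub, TOKEN FOR TOKEN>` (sorry-free): W1 and W3 are fed
BY NAME (`bigModuleFinite`, `weightTwoTransport_of_ESide`). [folklore] -/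
theorem weightTwoControlOfPub_of_subleaves
    (h2 : type_of% stub_weightTwoControlMap)
    (hE : type_of% stub_ESideOfPub)
    (h4 : type_of% stub_weightTwoPurity) :
    (((((lambdaMu_multiplicative_of_gvPar ∧ thm16_charIdeal_dvd_multiplicative_of_reducible ∧
    thm61_splitMultiplicative ∧ thm61_nonsplitMultiplicative ∧
    (∀ (W : WeierstrassCurve ℚ) [W.IsElliptic] [W.IsGloballyMinimal] (p : ℕ) [Fact p.Prime],
      greenberg_stevens (W := W) (p := p)) ∧
    exists_isNewformOf ∧
    hsieh2014_exists_anticyclotomicPAdicLFunction ∧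
    (∀ (N : ℕ) [NeZero N] (W : WeierstrassCurve ℚ) (K : Type) [Field K] [NumberField K],
      gross_zagier N W K) ∧
    (∀ (N : ℕ) [NeZero N] (W : WeierstrassCurve ℚ) (K : Type) [Field K] [NumberField K],
      kolyvagin N W K) ∧
    rank_eq_analyticRank_of_analyticRank_le_one ∧ HoffsteinLuo1997_exists_twist_L_one_ne_zero ∧
    mazur_not_dvd_maninConstant_of_odd ∧ bsdRHS_eq_of_isIsogenous) ∧
    thm210_thm211_bdpDisplay_pNew) ∧
    LiuZhangZhang2018.thm151_thm153_modularCurve_heegnerVector) ∧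
    (prop125_characterGrSelmerDual_torsion_muZero_dim ∧
      cor126_residualCharacter_globalLift ∧ cor126_residualCharacter_localSurjective ∧
      thm212_exists_isKatzLFunction ∧
      Literature.NumberTheory.EllipticCurves.Castella2018.cas20_thm211_memberForms_sigmaFrames_congr)) ∧
      Literature.NumberTheory.EllipticCurves.BCGKPST2020.thm331_rubin_exists_katzMeasure₂_pseudoIso_span_eq ∧
      Literature.NumberTheory.EllipticCurves.DeShalit1987.thmII64_katzMeasure₂_functionalEquation ∧
      Literature.NumberTheory.EllipticCurves.Hida2010MuInvariant.thmI_mu_katzBranch_reflect_eq_zero) →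
    ∀ (W : WeierstrassCurve ℚ) [W.IsElliptic] [W.IsGloballyMinimal] (p : ℕ) [Fact p.Prime],
    ∀ (N : ℕ) [NeZero N] (K : Type) [Field K] [NumberField K] (Dt : ModularParametrizationData W N)
      (H : HeegnerDatum N (NumberField.discr K)) (ιK : K →+* ℂ) (P : (W.baseChange K).toAffine.Point),
      CellC W p → W.conductorNorm ℤ = N →
      IsImaginaryQuadratic K → NumberField.discr K < -4 → SatisfiesHeegnerHypothesis N K →
      (W.quadraticTwist (NumberField.discr K : ℚ)).entireLFunction 1 ≠ 0 →
      WeierstrassCurve.Affine.Point.map ιK.toRatAlgHom P = heegnerPointComplex Dt H →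
      ¬ (p : ℤ) ∣ Dt.c → ¬ IsOfFinAddOrder P →
      Odd (NumberField.discr K) →
      ∀ (κ : ZpExtension K p), κ.IsAnticyclotomic →
        ∀ (γ : Field.absoluteGaloisGroup K) [Fact (κ.IsTopGenerator γ)]
          (𝔭 : HeightOneSpectrum (𝓞 K)), ((p : ℕ) : 𝓞 K) ∈ 𝔭.asIdeal →
          𝔭.asIdeal.ramificationIdx (𝓞 ℚ) = 1 → 𝔭.asIdeal.inertiaDeg (𝓞 ℚ) = 1 →
          ∀ (𝔭bar : HeightOneSpectrum (𝓞 K)), ((p : ℕ) : 𝓞 K) ∈ 𝔭bar.asIdeal → 𝔭bar ≠ 𝔭 →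
            ((Ideal.span {(p : ℤ)}).primesOver (𝓞 K)).ncard = 2 →
          ∀ (f : CuspForm (CongruenceSubgroup.Gamma0 N) 2), IsNewformOf W f →
            ∀ (ι' : PadicAlgCl p ≃+* ℂ),
              (∀ (w : InfinitePlace K) (k : 𝓞 K),
                k ∈ 𝔭.asIdeal ↔ ‖ι'.symm (w.embedding (k : K))‖ < 1) →
              ∀ (ΩK : ℂ) (Ωp : ℂ_[p]) (Q : PowerSeries 𝓞_ℂ_[p]), ΩK ≠ 0 → ‖Ωp‖ = 1 →
                R1.IsBDPLFunctionInt p ι' 𝔭 κ γ f ΩK Ωp Q →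
      ∀ (L : PowerSeries (PowerSeries (unrIntegers p))) (x : ℕ → ℤ_[p]) (D : ℕ → Skinner2016.HidaCongruentForm W p 1),
        (∀ k, ‖x k‖ < 1) ∧ Filter.Tendsto x Filter.atTop (nhds 0) ∧
        (∃ e : ℕ, PowerSeries.C ((p : 𝓞_ℂ_[p]) ^ e) * Q ∈
          Ideal.span {PowerSeries.map (R1.unrToCpInt p) (PowerSeries.map (PowerSeries.constantCoeff (R := unrIntegers p)) L)}) ∧
        (∀ k : ℕ, (∀ y : coeffField (D k).g, ι' ((D k).ι y) = (y : ℂ)) ∧ 2 * ((p : ℤ) - 1) ∣ (D k).k - 2 ∧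
          ∃ (ΩKg : ℂ) (Ωpg : ℂ_[p]) (Lg : UnrSeries p), ΩKg ≠ 0 ∧ ‖Ωpg‖ = 1 ∧
            IsBDPLFunctionWt ι' 𝔭 κ γ (D k).g ΩKg Ωpg Lg ∧
          ∃ Ψ : UnrSeries p,
            (∃ U : PowerSeries (PowerSeries (unrIntegers p)),
              PowerSeries.map (PowerSeries.C (R := unrIntegers p)) Ψ =
                L + PowerSeries.C (PowerSeries.X - PowerSeries.C (toUnr p (x k))) * U) ∧
            (∃ e : ℕ, PowerSeries.C ((p : 𝓞_ℂ_[p]) ^ e) * PowerSeries.map (R1.unrToCpInt p) Ψ ∈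
              Ideal.span {PowerSeries.map (R1.unrToCpInt p) Lg})) ∧
        (∃ A : ℕ → UnrSeries p, ∀ ℓ : ℕ, ℓ.Prime → ¬ ℓ ∣ N →
          (∃ U : UnrSeries p, A ℓ = PowerSeries.C (toUnr p ((W.frobeniusTrace ℓ : ℤ) : ℤ_[p])) + PowerSeries.X * U) ∧
          ∀ k : ℕ, ∃ (c : unrIntegers p) (U : UnrSeries p),
            A ℓ = PowerSeries.C c + (PowerSeries.X - PowerSeries.C (toUnr p (x k))) * U ∧
            ((c : ℂ_[p]) = algebraMap (PadicAlgCl p) ℂ_[p]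
              ((D k).ι ⟨(UpperHalfPlane.qExpansion 1 ⇑(D k).g).coeff ℓ, coeff_mem_coeffField (D k).g ℓ⟩))) →
      ∀ [TopologicalSpace (PowerSeries ℤ_[p])] (A₂ : Type) [AddCommGroup A₂]
        [Module (PowerSeries ℤ_[p]) A₂] [TopologicalSpace A₂] [DiscreteTopology A₂]
        (ρ₂ : ContinuousRep (Field.absoluteGaloisGroup K) (PowerSeries ℤ_[p]) A₂)
        [TopologicalSpace (PowerSeries (PowerSeries ℤ_[p]))]
        [ContinuousSMul (PowerSeries (PowerSeries ℤ_[p])) (BigRepModule (PowerSeries ℤ_[p]) p A₂)]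
        [Module (PowerSeries ℤ_[p]) (XBig κ ρ₂ 𝔭bar (∅ : Set (HeightOneSpectrum (𝓞 K))))]
        [IsScalarTower (PowerSeries ℤ_[p]) (PowerSeries (PowerSeries ℤ_[p]))
          (XBig κ ρ₂ 𝔭bar (∅ : Set (HeightOneSpectrum (𝓞 K))))],
        ((∀ a : A₂, ∃ n : ℕ, (PowerSeries.X : PowerSeries ℤ_[p]) ^ n • a = 0) ∧
          (∀ a : A₂, ∃ b : A₂, (PowerSeries.X : PowerSeries ℤ_[p]) • b = a) ∧
          (∀ (k : ℕ) (a : A₂), ∃ b : A₂, (PowerSeries.X - PowerSeries.C (x k)) • b = a) ∧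
          (∃ S₀ : Set (HeightOneSpectrum (𝓞 K)), S₀.Finite ∧ GaloisRep.IsUnramifiedOutside S₀ ρ₂) ∧
          (∃ θ₀ : Submodule.torsionBy (PowerSeries ℤ_[p]) A₂ (PowerSeries.X : PowerSeries ℤ_[p]) →+
              PrimaryTorsion (W.baseChange K).geomPoints p,
            (∀ (c : ℤ_[p]) (a : Submodule.torsionBy (PowerSeries ℤ_[p]) A₂ (PowerSeries.X : PowerSeries ℤ_[p])),
                θ₀ (PowerSeries.C c • a) = c • θ₀ a) ∧
            (∀ (σ : Field.absoluteGaloisGroup K)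
                (a : Submodule.torsionBy (PowerSeries ℤ_[p]) A₂ (PowerSeries.X : PowerSeries ℤ_[p])),
                θ₀ (BigGaloisRep.torsionRep ρ₂ (PowerSeries.X : PowerSeries ℤ_[p]) σ a) =
                  (W.baseChange K).primaryTorsionGaloisRep p σ (θ₀ a)) ∧
            Finite θ₀.ker ∧ Finite (PrimaryTorsion (W.baseChange K).geomPoints p ⧸ θ₀.range)) ∧
          (∀ k : ℕ, Function.Surjective (algebraMap ℤ_[p] (padicCoeffIntegers (D k).ι)) ∧
            ∃ θ : Submodule.torsionBy (PowerSeries ℤ_[p]) A₂ (PowerSeries.X - PowerSeries.C (x k)) →+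
                Cofree (D k).Δ.selfDualRep (padicCoeffField (D k).ι),
              (∀ (c : ℤ_[p])
                  (a : Submodule.torsionBy (PowerSeries ℤ_[p]) A₂ (PowerSeries.X - PowerSeries.C (x k))),
                  θ (PowerSeries.C c • a) = algebraMap ℤ_[p] (padicCoeffIntegers (D k).ι) c • θ a) ∧
              (∀ (σ : Field.absoluteGaloisGroup K)
                  (a : Submodule.torsionBy (PowerSeries ℤ_[p]) A₂ (PowerSeries.X - PowerSeries.C (x k))),
                  θ (BigGaloisRep.torsionRep ρ₂ (PowerSeries.X - PowerSeries.C (x k)) σ a) =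
                    (D k).Δ.selfDualCofreeRepOver K σ (θ a)) ∧
              Finite θ.ker ∧ Finite (Cofree (D k).Δ.selfDualRep (padicCoeffField (D k).ι) ⧸ θ.range))) →
        Module.Finite (PowerSeries (PowerSeries ℤ_[p])) (XBig κ ρ₂ 𝔭bar (∅ : Set (HeightOneSpectrum (𝓞 K)))) ∧
        (∃ s : PowerSeries (PowerSeries ℤ_[p]),
          ¬ (PowerSeries.C (PowerSeries.X : PowerSeries ℤ_[p]) ∣ s) ∧
            ∀ m : XBig κ ρ₂ 𝔭bar (∅ : Set (HeightOneSpectrum (𝓞 K))), s • m = 0) ∧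
        (∃ j : ℕ, Ideal.span {PowerSeries.C ((p : ℤ_[p]) ^ j)} *
            (Literature.NumberTheory.EllipticCurves.Module.charIdeal (PowerSeries (PowerSeries ℤ_[p]))
                (XBig κ ρ₂ 𝔭bar (∅ : Set (HeightOneSpectrum (𝓞 K))))).map
              (PowerSeries.map (PowerSeries.constantCoeff (R := ℤ_[p]))) ≤
          XAc.charIdeal (W.baseChange K) p κ 𝔭bar ∅ γ) := fun hPub ↦
  weightTwoControl_of_subleaves bigModuleFinite h2 (weightTwoTransport_of_ESide (hE hPub)) h4

/-! ## §K″ Kernel under PUB along route G (v1.2, sorry-free): W2 → ((PUB) → (I-E)) → W4⁰ → v10 `stub_weightTwoControlOfPub` -/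

set_option maxHeartbeats 1600000 in
/-- **Kernel v1.2** `W2 → stub_ESideOfPub → W4⁰ → <telescope v10 stub_weightTwoControlOfPub, TOKEN FOR TOKEN>` (sorry-free): W1 and W3 BY NAME
(`bigModuleFinite`, `weightTwoTransport_of_ESide`), W4 := `weightTwoPurity_of_pTolerant`. [folklore] -/
theorem weightTwoControlOfPub_of_pTolerant
    (h2 : type_of% stub_weightTwoControlMap)
    (hE : type_of% stub_ESideOfPub)
    (h4' : type_of% stub_bigPseudoNullPTorsion) :
    (((((lambdaMu_multiplicative_of_gvPar ∧ thm16_charIdeal_dvd_multiplicative_of_reducible ∧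
    thm61_splitMultiplicative ∧ thm61_nonsplitMultiplicative ∧
    (∀ (W : WeierstrassCurve ℚ) [W.IsElliptic] [W.IsGloballyMinimal] (p : ℕ) [Fact p.Prime],
      greenberg_stevens (W := W) (p := p)) ∧
    exists_isNewformOf ∧
    hsieh2014_exists_anticyclotomicPAdicLFunction ∧
    (∀ (N : ℕ) [NeZero N] (W : WeierstrassCurve ℚ) (K : Type) [Field K] [NumberField K],
      gross_zagier N W K) ∧
    (∀ (N : ℕ) [NeZero N] (W : WeierstrassCurve ℚ) (K : Type) [Field K] [NumberField K],
      kolyvagin N W K) ∧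
    rank_eq_analyticRank_of_analyticRank_le_one ∧ HoffsteinLuo1997_exists_twist_L_one_ne_zero ∧
    mazur_not_dvd_maninConstant_of_odd ∧ bsdRHS_eq_of_isIsogenous) ∧
    thm210_thm211_bdpDisplay_pNew) ∧
    LiuZhangZhang2018.thm151_thm153_modularCurve_heegnerVector) ∧
    (prop125_characterGrSelmerDual_torsion_muZero_dim ∧
      cor126_residualCharacter_globalLift ∧ cor126_residualCharacter_localSurjective ∧
      thm212_exists_isKatzLFunction ∧
      Literature.NumberTheory.EllipticCurves.Castella2018.cas20_thm211_memberForms_sigmaFrames_congr)) ∧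
      Literature.NumberTheory.EllipticCurves.BCGKPST2020.thm331_rubin_exists_katzMeasure₂_pseudoIso_span_eq ∧
      Literature.NumberTheory.EllipticCurves.DeShalit1987.thmII64_katzMeasure₂_functionalEquation ∧
      Literature.NumberTheory.EllipticCurves.Hida2010MuInvariant.thmI_mu_katzBranch_reflect_eq_zero) →
    ∀ (W : WeierstrassCurve ℚ) [W.IsElliptic] [W.IsGloballyMinimal] (p : ℕ) [Fact p.Prime],
    ∀ (N : ℕ) [NeZero N] (K : Type) [Field K] [NumberField K] (Dt : ModularParametrizationData W N)
      (H : HeegnerDatum N (NumberField.discr K)) (ιK : K →+* ℂ) (P : (W.baseChange K).toAffine.Point),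
      CellC W p → W.conductorNorm ℤ = N →
      IsImaginaryQuadratic K → NumberField.discr K < -4 → SatisfiesHeegnerHypothesis N K →
      (W.quadraticTwist (NumberField.discr K : ℚ)).entireLFunction 1 ≠ 0 →
      WeierstrassCurve.Affine.Point.map ιK.toRatAlgHom P = heegnerPointComplex Dt H →
      ¬ (p : ℤ) ∣ Dt.c → ¬ IsOfFinAddOrder P →
      Odd (NumberField.discr K) →
      ∀ (κ : ZpExtension K p), κ.IsAnticyclotomic →
        ∀ (γ : Field.absoluteGaloisGroup K) [Fact (κ.IsTopGenerator γ)]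
          (𝔭 : HeightOneSpectrum (𝓞 K)), ((p : ℕ) : 𝓞 K) ∈ 𝔭.asIdeal →
          𝔭.asIdeal.ramificationIdx (𝓞 ℚ) = 1 → 𝔭.asIdeal.inertiaDeg (𝓞 ℚ) = 1 →
          ∀ (𝔭bar : HeightOneSpectrum (𝓞 K)), ((p : ℕ) : 𝓞 K) ∈ 𝔭bar.asIdeal → 𝔭bar ≠ 𝔭 →
            ((Ideal.span {(p : ℤ)}).primesOver (𝓞 K)).ncard = 2 →
          ∀ (f : CuspForm (CongruenceSubgroup.Gamma0 N) 2), IsNewformOf W f →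
            ∀ (ι' : PadicAlgCl p ≃+* ℂ),
              (∀ (w : InfinitePlace K) (k : 𝓞 K),
                k ∈ 𝔭.asIdeal ↔ ‖ι'.symm (w.embedding (k : K))‖ < 1) →
              ∀ (ΩK : ℂ) (Ωp : ℂ_[p]) (Q : PowerSeries 𝓞_ℂ_[p]), ΩK ≠ 0 → ‖Ωp‖ = 1 →
                R1.IsBDPLFunctionInt p ι' 𝔭 κ γ f ΩK Ωp Q →
      ∀ (L : PowerSeries (PowerSeries (unrIntegers p))) (x : ℕ → ℤ_[p]) (D : ℕ → Skinner2016.HidaCongruentForm W p 1),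
        (∀ k, ‖x k‖ < 1) ∧ Filter.Tendsto x Filter.atTop (nhds 0) ∧
        (∃ e : ℕ, PowerSeries.C ((p : 𝓞_ℂ_[p]) ^ e) * Q ∈
          Ideal.span {PowerSeries.map (R1.unrToCpInt p) (PowerSeries.map (PowerSeries.constantCoeff (R := unrIntegers p)) L)}) ∧
        (∀ k : ℕ, (∀ y : coeffField (D k).g, ι' ((D k).ι y) = (y : ℂ)) ∧ 2 * ((p : ℤ) - 1) ∣ (D k).k - 2 ∧
          ∃ (ΩKg : ℂ) (Ωpg : ℂ_[p]) (Lg : UnrSeries p), ΩKg ≠ 0 ∧ ‖Ωpg‖ = 1 ∧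
            IsBDPLFunctionWt ι' 𝔭 κ γ (D k).g ΩKg Ωpg Lg ∧
          ∃ Ψ : UnrSeries p,
            (∃ U : PowerSeries (PowerSeries (unrIntegers p)),
              PowerSeries.map (PowerSeries.C (R := unrIntegers p)) Ψ =
                L + PowerSeries.C (PowerSeries.X - PowerSeries.C (toUnr p (x k))) * U) ∧
            (∃ e : ℕ, PowerSeries.C ((p : 𝓞_ℂ_[p]) ^ e) * PowerSeries.map (R1.unrToCpInt p) Ψ ∈
              Ideal.span {PowerSeries.map (R1.unrToCpInt p) Lg})) ∧
        (∃ A : ℕ → UnrSeries p, ∀ ℓ : ℕ, ℓ.Prime → ¬ ℓ ∣ N →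
          (∃ U : UnrSeries p, A ℓ = PowerSeries.C (toUnr p ((W.frobeniusTrace ℓ : ℤ) : ℤ_[p])) + PowerSeries.X * U) ∧
          ∀ k : ℕ, ∃ (c : unrIntegers p) (U : UnrSeries p),
            A ℓ = PowerSeries.C c + (PowerSeries.X - PowerSeries.C (toUnr p (x k))) * U ∧
            ((c : ℂ_[p]) = algebraMap (PadicAlgCl p) ℂ_[p]
              ((D k).ι ⟨(UpperHalfPlane.qExpansion 1 ⇑(D k).g).coeff ℓ, coeff_mem_coeffField (D k).g ℓ⟩))) →
      ∀ [TopologicalSpace (PowerSeries ℤ_[p])] (A₂ : Type) [AddCommGroup A₂]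
        [Module (PowerSeries ℤ_[p]) A₂] [TopologicalSpace A₂] [DiscreteTopology A₂]
        (ρ₂ : ContinuousRep (Field.absoluteGaloisGroup K) (PowerSeries ℤ_[p]) A₂)
        [TopologicalSpace (PowerSeries (PowerSeries ℤ_[p]))]
        [ContinuousSMul (PowerSeries (PowerSeries ℤ_[p])) (BigRepModule (PowerSeries ℤ_[p]) p A₂)]
        [Module (PowerSeries ℤ_[p]) (XBig κ ρ₂ 𝔭bar (∅ : Set (HeightOneSpectrum (𝓞 K))))]
        [IsScalarTower (PowerSeries ℤ_[p]) (PowerSeries (PowerSeries ℤ_[p]))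
          (XBig κ ρ₂ 𝔭bar (∅ : Set (HeightOneSpectrum (𝓞 K))))],
        ((∀ a : A₂, ∃ n : ℕ, (PowerSeries.X : PowerSeries ℤ_[p]) ^ n • a = 0) ∧
          (∀ a : A₂, ∃ b : A₂, (PowerSeries.X : PowerSeries ℤ_[p]) • b = a) ∧
          (∀ (k : ℕ) (a : A₂), ∃ b : A₂, (PowerSeries.X - PowerSeries.C (x k)) • b = a) ∧
          (∃ S₀ : Set (HeightOneSpectrum (𝓞 K)), S₀.Finite ∧ GaloisRep.IsUnramifiedOutside S₀ ρ₂) ∧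
          (∃ θ₀ : Submodule.torsionBy (PowerSeries ℤ_[p]) A₂ (PowerSeries.X : PowerSeries ℤ_[p]) →+
              PrimaryTorsion (W.baseChange K).geomPoints p,
            (∀ (c : ℤ_[p]) (a : Submodule.torsionBy (PowerSeries ℤ_[p]) A₂ (PowerSeries.X : PowerSeries ℤ_[p])),
                θ₀ (PowerSeries.C c • a) = c • θ₀ a) ∧
            (∀ (σ : Field.absoluteGaloisGroup K)
                (a : Submodule.torsionBy (PowerSeries ℤ_[p]) A₂ (PowerSeries.X : PowerSeries ℤ_[p])),
                θ₀ (BigGaloisRep.torsionRep ρ₂ (PowerSeries.X : PowerSeries ℤ_[p]) σ a) =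
                  (W.baseChange K).primaryTorsionGaloisRep p σ (θ₀ a)) ∧
            Finite θ₀.ker ∧ Finite (PrimaryTorsion (W.baseChange K).geomPoints p ⧸ θ₀.range)) ∧
          (∀ k : ℕ, Function.Surjective (algebraMap ℤ_[p] (padicCoeffIntegers (D k).ι)) ∧
            ∃ θ : Submodule.torsionBy (PowerSeries ℤ_[p]) A₂ (PowerSeries.X - PowerSeries.C (x k)) →+
                Cofree (D k).Δ.selfDualRep (padicCoeffField (D k).ι),
              (∀ (c : ℤ_[p])
                  (a : Submodule.torsionBy (PowerSeries ℤ_[p]) A₂ (PowerSeries.X - PowerSeries.C (x k))),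
                  θ (PowerSeries.C c • a) = algebraMap ℤ_[p] (padicCoeffIntegers (D k).ι) c • θ a) ∧
              (∀ (σ : Field.absoluteGaloisGroup K)
                  (a : Submodule.torsionBy (PowerSeries ℤ_[p]) A₂ (PowerSeries.X - PowerSeries.C (x k))),
                  θ (BigGaloisRep.torsionRep ρ₂ (PowerSeries.X - PowerSeries.C (x k)) σ a) =
                    (D k).Δ.selfDualCofreeRepOver K σ (θ a)) ∧
              Finite θ.ker ∧ Finite (Cofree (D k).Δ.selfDualRep (padicCoeffField (D k).ι) ⧸ θ.range))) →
        Module.Finite (PowerSeries (PowerSeries ℤ_[p])) (XBig κ ρ₂ 𝔭bar (∅ : Set (HeightOneSpectrum (𝓞 K)))) ∧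
        (∃ s : PowerSeries (PowerSeries ℤ_[p]),
          ¬ (PowerSeries.C (PowerSeries.X : PowerSeries ℤ_[p]) ∣ s) ∧
            ∀ m : XBig κ ρ₂ 𝔭bar (∅ : Set (HeightOneSpectrum (𝓞 K))), s • m = 0) ∧
        (∃ j : ℕ, Ideal.span {PowerSeries.C ((p : ℤ_[p]) ^ j)} *
            (Literature.NumberTheory.EllipticCurves.Module.charIdeal (PowerSeries (PowerSeries ℤ_[p]))
                (XBig κ ρ₂ 𝔭bar (∅ : Set (HeightOneSpectrum (𝓞 K))))).map
              (PowerSeries.map (PowerSeries.constantCoeff (R := ℤ_[p]))) ≤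
          XAc.charIdeal (W.baseChange K) p κ 𝔭bar ∅ γ) := fun hPub ↦
  weightTwoControl_of_subleaves bigModuleFinite h2 (weightTwoTransport_of_ESide (hE hPub))
    (weightTwoPurity_of_pTolerant h2 (weightTwoTransport_of_ESide (hE hPub)) h4')

end Summit.BirchSwinnertonDyer.BirchSwinnertonDyer.Cruxes.BSDpOnCellC.Telescope.K2Weight2

end
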